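import Literature.Computability.Cryptography.ImpagliazzoLevinOWF
import Literature.Computability.Complexity.BPPErrorReduction
import Literature.Computability.Complexity.CountingHierarchyProofs
import Literature.Computability.Cryptography.Sweep1
import HarnessLib

/-!
# Impagliazzo–Levin inversion, III: the probability analysis and B–T Theorem 22

This file proves the core of Bogdanov–Trevisan's Theorem 22 (ECCC TR06-073 §3.3; FnT §4.3) for the
construction of `ImpagliazzoLevinOWF.lean`: if `A` is a randomized heuristic scheme for `(L_f, U)`
(uniform bad-instance mass `≤ 1/m`, Def. 2.12) then the inverter `I = Params.inv` inverts `f` on a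
uniformly random `x ∈ {0,1}^n` with probability at least `31/1024` for every `n ≥ 1`
(`invertProb_ge`), and consequently **`(NP, U) ⊆ HeurBPP` excludes one-way functions**
(`not_isOneWay_of_subset_HeurBPP`, `distClass_NP_uniform_not_subset_HeurBPP_of_OWFExist_of`),
modulo the two efficiency statements — `L_f`'s verifier relation is in `P`, and `I` is PPT — which
are machine constructions discharged in `ImpagliazzoLevinVerifier.lean` /
`ImpagliazzoLevinInverter.lean` and enter here as hypotheses (not as named facts).

The four steps (all counting over uniform bit strings, `List.Vector Bool _`):

1. **Isolation** (`sixteen_mul_card_isolated_ge`): for every `x`, at the VV level `b` of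
   `S_x = f⁻¹(f x) ∩ {0,1}^n`, for at least `1/16` of the key pairs `(σ_h, σ_g)` the witness set of
   the queries is a single preimage `r₀` of `f x` — VV isolation (`vv_hashStr`, probability `≥ 1/8`)
   minus parasitic witnesses `r ∉ S_x` (union bound with `card_hashStr_collide` and
   `card_hashStr_eq_zeros`: `≤ 2^n · 2^{-a} · 2^{-b} = 1/16`) — B–T Thm. 29, "Density".
2. **Domination** (`sum_card_isolated_and_mem_le`): for each query index `(b, i)` and every set `F`
   of instances, `Σ_{x : level b} #{seeds : isolated ∧ z_{b,i} ∈ F} ≤ 8 · 2^{n+D} · U_N(F)` — two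
   contributors with the same query have the same `f`-value (the query determines the isolated
   witness), there are `≤ 2^{b-1}` of them, and each fibre of `seeds ↦ z` has `2^{free}` elements;
   B–T Thm. 29 "Domination" with Claim 28's disjointness.
3. **Amplification** (`card_exists_answer_ne_le`): on good queries all `n` majority answers are
   correct outside a `1/32` fraction of the coin strings (`card_maj_fail_le`, union bound).
4. **Assembly** (`invertProb_ge`): `Pr[I inverts] ≥ (1/16 - 1/32) · 31/32 = 31/1024`, using that a
   hit in the round `(b, κ)` (true level, true coin length) is a hit of the run (`f_run_eq`) and
   that a round segment of the uniform coin string is uniform (`card_filter_window`).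

## References

* A. Bogdanov, L. Trevisan, *Average-Case Complexity*, ECCC TR06-073 (2006) = Found. Trends TCS
  2(1) (2006): Thm. 22 (§3.3), Thm. 21 (§3.2), Claim 28 and Thm. 29 (§5.1), Cor. 30.
* R. Impagliazzo, L. Levin, FOCS 1990, §4 ("So, one only needs to show `λ(D_z) = |z|^{-O(1)}`").
-/

noncomputable section

open scoped Classical

namespace Literature.Computability.Cryptography

namespace ImpagliazzoLevin

open Finset Complexity Complexity.Nondeterministic MetaComplexity AffineStr _root_.Computability Filter Asymptotics

namespace Params

variable (P : Params)

/-! ### Step 1: isolation -/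

section Isolation

variable {n : ℕ}

/-- `S_x = f⁻¹(f x) ∩ {0,1}^n`, the preimages of `f x` of length `n`. [Bogdanov–Trevisan 2006, §3.3]
[folklore] -/
def Sx (x : List.Vector Bool n) : Finset (List.Vector Bool n) := univ.filter fun r => P.f r.toList = P.f x.toList

/-- `x ∈ S_x`. [folklore] -/
theorem mem_Sx_self (x : List.Vector Bool n) : x ∈ P.Sx x := by simp [Sx]

/-- **The level of `x`**: `b = ⌊log₂ |S_x|⌋ + 2`, the Valiant–Vazirani level of the witness count.
[Arora–Barak 2009, proof of Thm. 17.18; Bogdanov–Trevisan 2006, §3.2 ("`j` is the logarithm of the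
number of witnesses")] [folklore] -/
def lvl (x : List.Vector Bool n) : ℕ := Nat.log 2 (P.Sx x).card + 2

/-- The level is at most `n + 2`. [folklore] -/
theorem lvl_le (x : List.Vector Bool n) : P.lvl x ≤ n + 2 := by
  unfold lvl
  have h2 : (P.Sx x).card ≤ 2 ^ n := by
    calc (P.Sx x).card ≤ (univ : Finset (List.Vector Bool n)).card := card_le_univ _
      _ = 2 ^ n := by rw [card_univ, card_vector, Fintype.card_bool]
  have : Nat.log 2 (P.Sx x).card ≤ n :=
    calc Nat.log 2 (P.Sx x).card ≤ Nat.log 2 (2 ^ n) := Nat.log_mono_right h2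
      _ = n := Nat.log_pow (by norm_num) n
  omega

/-- The VV window of the level: `2^b ≤ 4 |S_x|`. [Arora–Barak 2009, Thm. 17.18 (proof)] [folklore] -/
theorem two_pow_lvl_le (x : List.Vector Bool n) : 2 ^ P.lvl x ≤ 4 * (P.Sx x).card := by
  unfold lvl
  have hpos : (P.Sx x).card ≠ 0 := card_ne_zero.2 ⟨x, P.mem_Sx_self x⟩
  rw [pow_add]
  have := Nat.pow_log_le_self 2 hpos
  omega

/-- The VV window of the level: `2 |S_x| ≤ 2^b`. [Arora–Barak 2009, Thm. 17.18 (proof)] [folklore] -/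
theorem two_mul_card_Sx_le (x : List.Vector Bool n) : 2 * (P.Sx x).card ≤ 2 ^ P.lvl x := by
  unfold lvl
  rw [pow_add]
  have := Nat.lt_pow_succ_log_self (b := 2) (by norm_num) (P.Sx x).card
  rw [pow_succ] at this
  omega

/-- **Isolation of a unique witness** by `g`: exactly one `r ∈ S_x` has `g_{σ_g}(r) = 0^b`.
[Bogdanov–Trevisan 2006, §3.2 ("there is a unique `w` satisfying `h|_j(w) = 0`")] [folklore] -/
def Iso (b : ℕ) (x : List.Vector Bool n) (σg : List Bool) : Prop :=
  ((P.Sx x).filter fun r => hG n b σg r.toList = List.replicate b false).card = 1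

/-- **No parasitic witness**: no `r ∉ S_x` collides with `x` under `h ∘ pad ∘ f` while hashing to
`0^b` under `g` (the complement of B–T's condition (2) of `V_x`). [Bogdanov–Trevisan 2006, §5.1.3
(`V_x`, condition (2))] [folklore] -/
def NoPar (b : ℕ) (x : List.Vector Bool n) (σh σg : List Bool) : Prop :=
  ∀ r : List.Vector Bool n, r ∉ P.Sx x →
    ¬ (P.hH n b σh (P.pad n (P.f r.toList)) = P.hH n b σh (P.pad n (P.f x.toList)) ∧
        hG n b σg r.toList = List.replicate b false)

/-- **The good key pairs** (B–T's "uniquely decodable" encodings `V_x`): isolation and no parasite.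
[Bogdanov–Trevisan 2006, §5.1.3 (`V_x`)] [cite: BogdanovTrevisan2006, Thm. 29 (ECCC TR06-073 §5.1.3, V_x)] -/
def Good (b : ℕ) (x : List.Vector Bool n) (σh σg : List Bool) : Prop := P.Iso b x σg ∧ P.NoPar b x σh σg

/-- **On good keys the witness set is a single preimage of `f x`.** [Bogdanov–Trevisan 2006, §5.1.3
("when `(y,h,g,k) ∈ V_x`, `M(y,h,g,k)` performs the same computation as `M_L(x)`")]
[cite: BogdanovTrevisan2006, Thm. 29 (ECCC TR06-073 §5.1.3)] -/
theorem exists_witSet_eq_singleton {b : ℕ} {x : List.Vector Bool n} {σh σg : List Bool}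
    (h : P.Good b x σh σg) :
    ∃ r₀ : List.Vector Bool n, witSet P n b (P.f x.toList) σh σg = {r₀} ∧ P.f r₀.toList = P.f x.toList := by
  obtain ⟨hiso, hnp⟩ := h
  obtain ⟨r₀, hr₀⟩ := card_eq_one.1 hiso
  have hmem : r₀ ∈ (P.Sx x).filter fun r => hG n b σg r.toList = List.replicate b false := by
    rw [hr₀]; exact mem_singleton_self _
  rw [mem_filter] at hmem
  have hfx : P.f r₀.toList = P.f x.toList := by simpa [Sx] using hmem.1
  refine ⟨r₀, ?_, hfx⟩
  ext r
  simp only [witSet, mem_filter, mem_univ, true_and, mem_singleton]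
  constructor
  · rintro ⟨h1, h2⟩
    by_cases hr : r ∈ P.Sx x
    · have : r ∈ (P.Sx x).filter fun r => hG n b σg r.toList = List.replicate b false := mem_filter.2 ⟨hr, h2⟩
      rw [hr₀] at this
      exact mem_singleton.1 this
    · exact absurd ⟨h1, h2⟩ (hnp r hr)
  · rintro rfl
    exact ⟨by rw [hfx], hmem.2⟩

/-- **Valiant–Vazirani at the level of `x`**: at least `1/8` of the keys `σ_g ∈ {0,1}^{L_g(n)}`
isolate a unique element of `S_x`. [Valiant–Vazirani 1986; Bogdanov–Trevisan 2006, §3.2]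
[cite: BogdanovTrevisan2006, Thm. 21 (ECCC TR06-073 §3.2)] -/
theorem card_Iso_ge (x : List.Vector Bool n) :
    2 ^ Lg n ≤ 8 * (univ.filter fun σg : List.Vector Bool (Lg n) => P.Iso (P.lvl x) x σg.toList).card := by
  have hℓ : P.lvl x * (n + 1) ≤ Lg n := by
    unfold Lg; exact Nat.mul_le_mul_right _ (P.lvl_le x)
  have h := vv_hashStr hℓ (P.Sx x) (P.two_pow_lvl_le x) (P.two_mul_card_Sx_le x)
  unfold Iso hG
  convert h using 4

/-- **Few parasites**: the key pairs admitting a parasitic witness are at most a `2^n/2^{a+b} = 1/16`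
fraction (union bound over `r ∉ S_x`; for each, the collision `h(pad f r) = h(pad f x)` has
probability `2^{-a}` — `pad ∘ f` is injective across different images — and `g(r) = 0^b` has
probability `2^{-b}`, independently). Requires `|f x'| ≤ p(n)` on `n`-bit inputs.
[Bogdanov–Trevisan 2006, §5.1.3 (proof of Thm. 29: "`Pr_{h,g}[∃ r : S(n;r) ≠ x and h(S(n;r)) = h(x)
and g(r) = 0] ≤ Σ_r 2^{-k-7} 2^{-m(n)+k+4} = 1/8`")] [cite: BogdanovTrevisan2006, Thm. 29 (ECCC TR06-073 §5.1.3, proof)] -/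
theorem sixteen_mul_card_par_le (hP : ∀ x, (P.f x).length ≤ P.p.eval x.length) {b : ℕ} (hb : b ≤ n + 2) (x : List.Vector Bool n) :
    16 * (univ.filter fun w : List.Vector Bool (P.Lh n + Lg n) =>
        ¬ P.NoPar b x (w.toList.take (P.Lh n)) (w.toList.drop (P.Lh n))).card ≤ 2 ^ (P.Lh n + Lg n) := by
  set a := n + 4 - b with ha
  have hab : a + b = n + 4 := by omega
  -- the parasite event is a union over `r ∉ S_x` of product events
  have hsub : (univ.filter fun w : List.Vector Bool (P.Lh n + Lg n) =>
        ¬ P.NoPar b x (w.toList.take (P.Lh n)) (w.toList.drop (P.Lh n))) ⊆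
      (univ.filter fun r : List.Vector Bool n => r ∉ P.Sx x).biUnion fun r =>
        univ.filter fun w : List.Vector Bool (P.Lh n + Lg n) =>
          P.hH n b (w.toList.take (P.Lh n)) (P.pad n (P.f r.toList)) =
              P.hH n b (w.toList.take (P.Lh n)) (P.pad n (P.f x.toList)) ∧
            hG n b (w.toList.drop (P.Lh n)) r.toList = List.replicate b false := by
    intro w hw
    simp only [mem_filter, mem_univ, true_and, NoPar, not_forall, not_not, exists_prop] at hw
    obtain ⟨r, hr, hcoll⟩ := hw
    exact mem_biUnion.2 ⟨r, mem_filter.2 ⟨mem_univ _, hr⟩, mem_filter.2 ⟨mem_univ _, hcoll⟩⟩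
  -- each product event has `2^{Lh} / 2^a · 2^{Lg} / 2^b` elements
  have hterm : ∀ r : List.Vector Bool n, r ∉ P.Sx x →
      (univ.filter fun w : List.Vector Bool (P.Lh n + Lg n) =>
          P.hH n b (w.toList.take (P.Lh n)) (P.pad n (P.f r.toList)) =
              P.hH n b (w.toList.take (P.Lh n)) (P.pad n (P.f x.toList)) ∧
            hG n b (w.toList.drop (P.Lh n)) r.toList = List.replicate b false).card * 2 ^ (n + 4) =
        2 ^ (P.Lh n + Lg n) := by
    intro r hr
    have hne : P.f r.toList ≠ P.f x.toList := by simpa [Sx] using hr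
    -- the padded images as vectors of length `Pd n`
    have hlr : (P.pad n (P.f r.toList)).length = P.Pd n := P.length_pad (by simpa using hP r.toList)
    have hlx : (P.pad n (P.f x.toList)).length = P.Pd n := P.length_pad (by simpa using hP x.toList)
    set ur : List.Vector Bool (P.Pd n) := ⟨P.pad n (P.f r.toList), hlr⟩ with hur
    set ux : List.Vector Bool (P.Pd n) := ⟨P.pad n (P.f x.toList), hlx⟩ with hux
    have huv : ur ≠ ux := by
      intro h
      have h' := congrArg List.Vector.toList h
      simp only [hur, hux, List.Vector.toList_mk] at h'
      exact hne (P.pad_injective n h')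
    have hℓh : a * (P.Pd n + 1) ≤ P.Lh n := by unfold Lh; exact Nat.mul_le_mul_right _ (by omega)
    have hcoll : (univ.filter fun σ : List.Vector Bool (P.Lh n) =>
        hashStr (P.Pd n) a σ.toList ur.toList = hashStr (P.Pd n) a σ.toList ux.toList).card * 2 ^ a = 2 ^ P.Lh n := by
      convert card_hashStr_collide hℓh huv using 4
    have hℓg : b * (n + 1) ≤ Lg n := by unfold Lg; exact Nat.mul_le_mul_right _ hb
    have hzero : (univ.filter fun σ : List.Vector Bool (Lg n) =>
        hashStr n b σ.toList r.toList = List.replicate b false).card * 2 ^ b = 2 ^ Lg n := by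
      convert card_hashStr_eq_zeros hℓg r using 4
    have hprod := Yao.card_filter_take_drop (P.Lh n) (Lg n)
      (fun σ => hashStr (P.Pd n) a σ ur.toList = hashStr (P.Pd n) a σ ux.toList)
      (fun σ => hashStr n b σ r.toList = List.replicate b false)
    have hev : (univ.filter fun w : List.Vector Bool (P.Lh n + Lg n) =>
          P.hH n b (w.toList.take (P.Lh n)) (P.pad n (P.f r.toList)) =
              P.hH n b (w.toList.take (P.Lh n)) (P.pad n (P.f x.toList)) ∧
            hG n b (w.toList.drop (P.Lh n)) r.toList = List.replicate b false) =
        univ.filter fun w : List.Vector Bool (P.Lh n + Lg n) =>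
          hashStr (P.Pd n) a (w.toList.take (P.Lh n)) ur.toList = hashStr (P.Pd n) a (w.toList.take (P.Lh n)) ux.toList ∧
            hashStr n b (w.toList.drop (P.Lh n)) r.toList = List.replicate b false := by
      congr 1
    rw [hev]
    rw [show (univ.filter fun w : List.Vector Bool (P.Lh n + Lg n) =>
          hashStr (P.Pd n) a (w.toList.take (P.Lh n)) ur.toList = hashStr (P.Pd n) a (w.toList.take (P.Lh n)) ux.toList ∧
            hashStr n b (w.toList.drop (P.Lh n)) r.toList = List.replicate b false).card =
        (univ.filter fun σ : List.Vector Bool (P.Lh n) =>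
            hashStr (P.Pd n) a σ.toList ur.toList = hashStr (P.Pd n) a σ.toList ux.toList).card *
          (univ.filter fun σ : List.Vector Bool (Lg n) => hashStr n b σ.toList r.toList = List.replicate b false).card by
        convert hprod using 2]
    rw [← hab, pow_add, pow_add]
    calc _ = ((univ.filter fun σ : List.Vector Bool (P.Lh n) =>
            hashStr (P.Pd n) a σ.toList ur.toList = hashStr (P.Pd n) a σ.toList ux.toList).card * 2 ^ a) *
          ((univ.filter fun σ : List.Vector Bool (Lg n) => hashStr n b σ.toList r.toList = List.replicate b false).card *
            2 ^ b) := by ring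
      _ = 2 ^ P.Lh n * 2 ^ Lg n := by rw [hcoll, hzero]
  -- union bound: at most `2^n` terms
  have hcount : (univ.filter fun r : List.Vector Bool n => r ∉ P.Sx x).card ≤ 2 ^ n :=
    (card_le_univ _).trans (by rw [card_vector, Fintype.card_bool])
  calc 16 * (univ.filter fun w : List.Vector Bool (P.Lh n + Lg n) =>
          ¬ P.NoPar b x (w.toList.take (P.Lh n)) (w.toList.drop (P.Lh n))).card
      ≤ 16 * ∑ r ∈ univ.filter (fun r : List.Vector Bool n => r ∉ P.Sx x),
          (univ.filter fun w : List.Vector Bool (P.Lh n + Lg n) =>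
            P.hH n b (w.toList.take (P.Lh n)) (P.pad n (P.f r.toList)) =
                P.hH n b (w.toList.take (P.Lh n)) (P.pad n (P.f x.toList)) ∧
              hG n b (w.toList.drop (P.Lh n)) r.toList = List.replicate b false).card :=
        Nat.mul_le_mul_left _ ((card_le_card hsub).trans card_biUnion_le)
    _ ≤ 2 ^ (P.Lh n + Lg n) := by
        -- multiply through by `2^n`: each term times `2^{n+4}` is `2^{Lh+Lg}`
        refine Nat.le_of_mul_le_mul_right ?_ (Nat.two_pow_pos n)
        rw [Nat.mul_assoc, Finset.sum_mul, show (16 : ℕ) = 2 ^ 4 by norm_num]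
        calc 2 ^ 4 * ∑ r ∈ univ.filter (fun r : List.Vector Bool n => r ∉ P.Sx x),
              (univ.filter fun w : List.Vector Bool (P.Lh n + Lg n) =>
                P.hH n b (w.toList.take (P.Lh n)) (P.pad n (P.f r.toList)) =
                    P.hH n b (w.toList.take (P.Lh n)) (P.pad n (P.f x.toList)) ∧
                  hG n b (w.toList.drop (P.Lh n)) r.toList = List.replicate b false).card * 2 ^ n
            = ∑ r ∈ univ.filter (fun r : List.Vector Bool n => r ∉ P.Sx x),
              (univ.filter fun w : List.Vector Bool (P.Lh n + Lg n) =>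
                P.hH n b (w.toList.take (P.Lh n)) (P.pad n (P.f r.toList)) =
                    P.hH n b (w.toList.take (P.Lh n)) (P.pad n (P.f x.toList)) ∧
                  hG n b (w.toList.drop (P.Lh n)) r.toList = List.replicate b false).card * 2 ^ (n + 4) := by
              rw [Finset.mul_sum]
              refine sum_congr rfl fun r _ => ?_
              rw [pow_add]; ring
          _ = ∑ r ∈ univ.filter (fun r : List.Vector Bool n => r ∉ P.Sx x), 2 ^ (P.Lh n + Lg n) :=
              sum_congr rfl fun r hr => hterm r (mem_filter.1 hr).2
          _ ≤ 2 ^ n * 2 ^ (P.Lh n + Lg n) := by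
              rw [sum_const, smul_eq_mul]; exact Nat.mul_le_mul_right _ hcount
          _ = 2 ^ (P.Lh n + Lg n) * 2 ^ n := Nat.mul_comm _ _

/-- **Good key pairs have density at least `1/16`** at the level of `x`:
`2^{L_h + L_g} ≤ 16 · #{(σ_h, σ_g) : Good}` (isolation `≥ 1/8` minus parasites `≤ 1/16`; B–T's
"Density: `Pr_{h,g}[(M,(h(x),h,g,k),1^{t(n)}) ∈ V_x | k = k(x)] ≥ 3/4`", here with the constants of
the merged isolation step). [Bogdanov–Trevisan 2006, §5.1.3 (proof of Thm. 29, Density)]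
[cite: BogdanovTrevisan2006, Thm. 29 (ECCC TR06-073 §5.1.3, Density)] -/
theorem sixteen_mul_card_good_ge (hP : ∀ x, (P.f x).length ≤ P.p.eval x.length) (x : List.Vector Bool n) :
    2 ^ (P.Lh n + Lg n) ≤ 16 * (univ.filter fun w : List.Vector Bool (P.Lh n + Lg n) =>
      P.Good (P.lvl x) x (w.toList.take (P.Lh n)) (w.toList.drop (P.Lh n))).card := by
  set G := univ.filter fun w : List.Vector Bool (P.Lh n + Lg n) =>
      P.Good (P.lvl x) x (w.toList.take (P.Lh n)) (w.toList.drop (P.Lh n)) with hG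
  set I := univ.filter fun w : List.Vector Bool (P.Lh n + Lg n) => P.Iso (P.lvl x) x (w.toList.drop (P.Lh n)) with hI
  set Bd := univ.filter fun w : List.Vector Bool (P.Lh n + Lg n) =>
      ¬ P.NoPar (P.lvl x) x (w.toList.take (P.Lh n)) (w.toList.drop (P.Lh n)) with hBd
  have hIsub : I ⊆ G ∪ Bd := by
    intro w hw
    rw [mem_union]
    by_cases hnp : P.NoPar (P.lvl x) x (w.toList.take (P.Lh n)) (w.toList.drop (P.Lh n))
    · exact Or.inl (mem_filter.2 ⟨mem_univ _, (mem_filter.1 hw).2, hnp⟩)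
    · exact Or.inr (mem_filter.2 ⟨mem_univ _, hnp⟩)
  have hIcard : 2 ^ (P.Lh n + Lg n) ≤ 8 * I.card := by
    have h1 := P.card_Iso_ge x
    have h2 : I.card = 2 ^ P.Lh n * (univ.filter fun σg : List.Vector Bool (Lg n) => P.Iso (P.lvl x) x σg.toList).card := by
      rw [hI]; convert card_filter_drop (P.Lh n) (Lg n) (fun σg => P.Iso (P.lvl x) x σg) using 2
    rw [h2, pow_add]
    calc 2 ^ P.Lh n * 2 ^ Lg n ≤ 2 ^ P.Lh n * (8 * (univ.filter fun σg : List.Vector Bool (Lg n) =>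
          P.Iso (P.lvl x) x σg.toList).card) := Nat.mul_le_mul_left _ h1
      _ = _ := by ring
  have hBd16 : 16 * Bd.card ≤ 2 ^ (P.Lh n + Lg n) := P.sixteen_mul_card_par_le hP (P.lvl_le x) x
  have hle : I.card ≤ G.card + Bd.card := (card_le_card hIsub).trans (card_union_le _ _)
  omega

end Isolation

/-! ### Step 2: domination -/

section Domination

variable {n : ℕ}

/-- The number of free seed bits of the query `(b, i)`: the unused `n + 4 - b` pad bits and the
unused `J_pool - J` junk bits. [folklore] -/
def free (n b i : ℕ) : ℕ := (n + 4 - b) + (Jpool n - Jn n b i)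

/-- **Prefix patterns**: `#{s ∈ {0,1}^{a+c} : s↾a = α ∧ R (s⇂a)} = #{w ∈ {0,1}^c : R w}` for `|α| = a`.
[folklore] -/
theorem card_filter_take_eq_and (a c : ℕ) {α : List Bool} (hα : α.length = a) (R : List Bool → Prop) :
    (univ.filter fun s : List.Vector Bool (a + c) => s.toList.take a = α ∧ R (s.toList.drop a)).card =
      (univ.filter fun w : List.Vector Bool c => R w.toList).card := by
  have h := Yao.card_filter_take_drop a c (fun u => u = α) R
  have h1 : (univ.filter fun u : List.Vector Bool a => u.toList = α).card = 1 := by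
    rw [card_eq_one]
    refine ⟨⟨α, hα⟩, ?_⟩
    ext u
    simp only [mem_filter, mem_univ, true_and, mem_singleton]
    constructor
    · intro hu; exact List.Vector.toList_injective hu
    · rintro rfl; rfl
  rw [h1, one_mul] at h
  convert h using 2

/-- Lengths of the fields cut out of a seed string of length `D(n)`. [folklore] -/
theorem length_fields {b i : ℕ} (hb : b ≤ n + 2) (hi : i < n) (s : List.Vector Bool (P.Dn n)) :
    (s.toList.take (P.Lh n)).length = P.Lh n ∧ ((s.toList.drop (P.Lh n)).take (Lg n)).length = Lg n ∧
      (((s.toList.drop (P.Lh n)).drop (Lg n)).take (n + 4)).length = n + 4 ∧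
        ((((s.toList.drop (P.Lh n)).drop (Lg n)).drop (n + 4)).take (Jpool n)).length = Jpool n ∧
          ((((s.toList.drop (P.Lh n)).drop (Lg n)).take (n + 4)).take b).length = b ∧
            (((((s.toList.drop (P.Lh n)).drop (Lg n)).drop (n + 4)).take (Jpool n)).take (Jn n b i)).length = Jn n b i := by
  have hJ := Jn_le_Jpool hb hi
  have hs : s.toList.length = P.Dn n := s.toList_length
  simp only [List.length_take, List.length_drop, hs]
  unfold Dn
  omega

/-- Lengths of the four fields of a seed string of length `D(n)` (keys, pad, pool). [folklore] -/
theorem length_fields₀ (s : List.Vector Bool (P.Dn n)) :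
    (s.toList.take (P.Lh n)).length = P.Lh n ∧ ((s.toList.drop (P.Lh n)).take (Lg n)).length = Lg n ∧
      (((s.toList.drop (P.Lh n)).drop (Lg n)).take (n + 4)).length = n + 4 ∧
        ((((s.toList.drop (P.Lh n)).drop (Lg n)).drop (n + 4)).take (Jpool n)).length = Jpool n := by
  have hs : s.toList.length = P.Dn n := s.toList_length
  simp only [List.length_take, List.length_drop, hs]
  unfold Dn
  omega

/-- Length of a seed-built query: `N(n,b,i)` on seeds of length `D(n)`. [folklore] -/
theorem length_squery {b i : ℕ} (hb : b ≤ n + 2) (hi : i < n) (y : List Bool) (s : List.Vector Bool (P.Dn n)) :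
    (P.squery n b i y s.toList).length = P.Nlen n b i := by
  obtain ⟨l1, l2, l3, l4, -, -⟩ := P.length_fields hb hi s
  exact length_query l1 l2 l3 l4 hb hi

/-- **The seed pattern of a query has `2^{free}` completions**: the seeds whose `h`-key, `g`-key,
first `b` pad bits and first `J(n,b,i)` junk bits are prescribed number `2^{free(n,b,i)}`. [folklore] -/
theorem card_pattern {b i : ℕ} (hb : b ≤ n + 2) (hi : i < n) {α β γ δ : List Bool}
    (hα : α.length = P.Lh n) (hβ : β.length = Lg n) (hγ : γ.length = b) (hδ : δ.length = Jn n b i) :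
    (univ.filter fun s : List.Vector Bool (P.Dn n) =>
        s.toList.take (P.Lh n) = α ∧ (s.toList.drop (P.Lh n)).take (Lg n) = β ∧
          ((s.toList.drop (P.Lh n)).drop (Lg n)).take b = γ ∧
            (((s.toList.drop (P.Lh n)).drop (Lg n)).drop (n + 4)).take (Jn n b i) = δ).card = 2 ^ free n b i := by
  have hJ := Jn_le_Jpool hb hi
  have hdrop : ∀ w : List Bool, w.drop (n + 4) = (w.drop b).drop (n + 4 - b) := by
    intro w; rw [List.drop_drop]; congr 1; omega
  rw [Yao.card_filter_vector_congr (show P.Dn n = P.Lh n + (Lg n + ((n + 4) + Jpool n)) from rfl)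
    (fun l => l.take (P.Lh n) = α ∧ (l.drop (P.Lh n)).take (Lg n) = β ∧ ((l.drop (P.Lh n)).drop (Lg n)).take b = γ ∧
      (((l.drop (P.Lh n)).drop (Lg n)).drop (n + 4)).take (Jn n b i) = δ)]
  calc (univ.filter fun s : List.Vector Bool (P.Lh n + (Lg n + ((n + 4) + Jpool n))) =>
        s.toList.take (P.Lh n) = α ∧ (s.toList.drop (P.Lh n)).take (Lg n) = β ∧
          ((s.toList.drop (P.Lh n)).drop (Lg n)).take b = γ ∧
            (((s.toList.drop (P.Lh n)).drop (Lg n)).drop (n + 4)).take (Jn n b i) = δ).card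
      = (univ.filter fun w : List.Vector Bool (Lg n + ((n + 4) + Jpool n)) =>
          w.toList.take (Lg n) = β ∧ (w.toList.drop (Lg n)).take b = γ ∧
            ((w.toList.drop (Lg n)).drop (n + 4)).take (Jn n b i) = δ).card := by
        convert card_filter_take_eq_and (P.Lh n) (Lg n + ((n + 4) + Jpool n)) hα
          (fun w => w.take (Lg n) = β ∧ (w.drop (Lg n)).take b = γ ∧ ((w.drop (Lg n)).drop (n + 4)).take (Jn n b i) = δ)
          using 3
    _ = (univ.filter fun w : List.Vector Bool ((n + 4) + Jpool n) =>
          w.toList.take b = γ ∧ (w.toList.drop (n + 4)).take (Jn n b i) = δ).card := by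
        convert card_filter_take_eq_and (Lg n) ((n + 4) + Jpool n) hβ
          (fun w => w.take b = γ ∧ (w.drop (n + 4)).take (Jn n b i) = δ) using 3
    _ = (univ.filter fun w : List.Vector Bool (b + ((n + 4 - b) + Jpool n)) =>
          w.toList.take b = γ ∧ ((w.toList.drop b).drop (n + 4 - b)).take (Jn n b i) = δ).card := by
        rw [Yao.card_filter_vector_congr (show (n + 4) + Jpool n = b + ((n + 4 - b) + Jpool n) by omega)
          (fun w => w.take b = γ ∧ (w.drop (n + 4)).take (Jn n b i) = δ)]
        simp_rw [hdrop]
    _ = (univ.filter fun w : List.Vector Bool ((n + 4 - b) + Jpool n) =>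
          (w.toList.drop (n + 4 - b)).take (Jn n b i) = δ).card := by
        convert card_filter_take_eq_and b ((n + 4 - b) + Jpool n) hγ
          (fun w => (w.drop (n + 4 - b)).take (Jn n b i) = δ) using 3
    _ = 2 ^ (n + 4 - b) * (univ.filter fun w : List.Vector Bool (Jpool n) => w.toList.take (Jn n b i) = δ).card := by
        convert card_filter_drop (n + 4 - b) (Jpool n) (fun w => w.take (Jn n b i) = δ) using 3
    _ = 2 ^ (n + 4 - b) * (univ.filter fun w : List.Vector Bool (Jn n b i + (Jpool n - Jn n b i)) =>
          w.toList.take (Jn n b i) = δ ∧ True).card := by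
        rw [Yao.card_filter_vector_congr (show Jpool n = Jn n b i + (Jpool n - Jn n b i) by omega)
          (fun w => w.take (Jn n b i) = δ)]
        simp only [and_true]
    _ = 2 ^ (n + 4 - b) * (univ.filter fun w : List.Vector Bool (Jpool n - Jn n b i) => True).card := by
        congr 1
        convert card_filter_take_eq_and (Jn n b i) (Jpool n - Jn n b i) hδ (fun _ => True) using 3
    _ = 2 ^ free n b i := by
        rw [Finset.filter_true_of_mem (fun _ _ => trivial), card_univ, card_vector, Fintype.card_bool, free, pow_add]

/-- **Equal queries have equal prescribed fields** (the query exhibits the keys, the used pad bits and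
the used junk bits verbatim, and the `h`-value). [folklore] -/
theorem fields_eq_of_squery_eq {b i : ℕ} (hb : b ≤ n + 2) (hi : i < n) {y₁ y₂ : List Bool}
    {s₁ s₂ : List.Vector Bool (P.Dn n)} (he : P.squery n b i y₁ s₁.toList = P.squery n b i y₂ s₂.toList) :
    s₁.toList.take (P.Lh n) = s₂.toList.take (P.Lh n) ∧
      (s₁.toList.drop (P.Lh n)).take (Lg n) = (s₂.toList.drop (P.Lh n)).take (Lg n) ∧
        P.hH n b (s₁.toList.take (P.Lh n)) (P.pad n y₁) = P.hH n b (s₂.toList.take (P.Lh n)) (P.pad n y₂) ∧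
          ((s₁.toList.drop (P.Lh n)).drop (Lg n)).take b = ((s₂.toList.drop (P.Lh n)).drop (Lg n)).take b ∧
            (((s₁.toList.drop (P.Lh n)).drop (Lg n)).drop (n + 4)).take (Jn n b i) =
              (((s₂.toList.drop (P.Lh n)).drop (Lg n)).drop (n + 4)).take (Jn n b i) := by
  have hJ := Jn_le_Jpool hb hi
  have hb4 : b ≤ n + 4 := by omega
  obtain ⟨l1, -, -, -, l5, l6⟩ := P.length_fields hb hi s₁
  obtain ⟨m1, -, -, -, m5, m6⟩ := P.length_fields hb hi s₂
  unfold squery query at he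
  obtain ⟨he4, e5⟩ := List.append_inj' he (by rw [l6, m6])
  obtain ⟨he3, e4⟩ := List.append_inj' he4 (by rw [l5, m5])
  obtain ⟨he2, ev⟩ := List.append_inj' he3 (by rw [length_hH, length_hH])
  obtain ⟨e1, e2⟩ := List.append_inj he2 (by rw [l1, m1])
  refine ⟨e1, e2, ev, ?_, ?_⟩
  · rw [List.take_take, Nat.min_eq_left hb4, List.take_take, Nat.min_eq_left hb4] at e4
    exact e4
  · rw [List.take_take, Nat.min_eq_left hJ, List.take_take, Nat.min_eq_left hJ] at e5
    exact e5

/-- **Fibres of `seeds ↦ query` are small**: at most `2^{free}` seeds of length `D(n)` yield a given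
query `z`. [Bogdanov–Trevisan 2006, §5.1.3 (Domination: "`Pr_y[y = h(x) | k = k(x)]`…")] [folklore] -/
theorem card_filter_squery_eq_le {b i : ℕ} (hb : b ≤ n + 2) (hi : i < n) (y z : List Bool) :
    (univ.filter fun s : List.Vector Bool (P.Dn n) => P.squery n b i y s.toList = z).card ≤ 2 ^ free n b i := by
  rcases (univ.filter fun s : List.Vector Bool (P.Dn n) => P.squery n b i y s.toList = z).eq_empty_or_nonempty with h0 | ⟨s₀, hs₀⟩
  · rw [h0, card_empty]; exact Nat.zero_le _
  have hq₀ : P.squery n b i y s₀.toList = z := (mem_filter.1 hs₀).2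
  have hJ := Jn_le_Jpool hb hi
  have hb4 : b ≤ n + 4 := by omega
  obtain ⟨m1, m2, -, -, m5, m6⟩ := P.length_fields hb hi s₀
  rw [List.take_take, Nat.min_eq_left hb4] at m5
  rw [List.take_take, Nat.min_eq_left hJ] at m6
  calc (univ.filter fun s : List.Vector Bool (P.Dn n) => P.squery n b i y s.toList = z).card
      ≤ (univ.filter fun s : List.Vector Bool (P.Dn n) =>
          s.toList.take (P.Lh n) = s₀.toList.take (P.Lh n) ∧
            (s.toList.drop (P.Lh n)).take (Lg n) = (s₀.toList.drop (P.Lh n)).take (Lg n) ∧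
              ((s.toList.drop (P.Lh n)).drop (Lg n)).take b = ((s₀.toList.drop (P.Lh n)).drop (Lg n)).take b ∧
                (((s.toList.drop (P.Lh n)).drop (Lg n)).drop (n + 4)).take (Jn n b i) =
                  (((s₀.toList.drop (P.Lh n)).drop (Lg n)).drop (n + 4)).take (Jn n b i)).card := by
        refine card_le_card fun s hs => mem_filter.2 ⟨mem_univ _, ?_⟩
        obtain ⟨e1, e2, -, e3, e4⟩ := P.fields_eq_of_squery_eq hb hi (((mem_filter.1 hs).2).trans hq₀.symm)
        exact ⟨e1, e2, e3, e4⟩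
    _ = 2 ^ free n b i := P.card_pattern hb hi m1 m2 m5 m6

/-- The good-seed event of `x` at its own level, on a seed string `s` (keys read off `s`). [folklore] -/
def GoodS (x : List.Vector Bool n) (s : List Bool) : Prop :=
  P.Good (P.lvl x) x (s.take (P.Lh n)) ((s.drop (P.Lh n)).take (Lg n))

/-- **Two contributors with the same query have the same image** (Claim 28's disjointness of the
`V_x`, in our merged form: a good query determines its unique witness, a preimage of the image).
[Bogdanov–Trevisan 2006, §5.1.1 (Disjointness) and proof of Claim 28]
[cite: BogdanovTrevisan2006, Claim 28 (ECCC TR06-073 §5.1.1)] -/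
theorem f_eq_of_squery_eq {b i : ℕ} (hb : b ≤ n + 2) (hi : i < n) {x₁ x₂ : List.Vector Bool n}
    (hl₁ : P.lvl x₁ = b) (hl₂ : P.lvl x₂ = b) {s₁ s₂ : List.Vector Bool (P.Dn n)}
    (hg₁ : P.GoodS x₁ s₁.toList) (hg₂ : P.GoodS x₂ s₂.toList)
    (he : P.squery n b i (P.f x₁.toList) s₁.toList = P.squery n b i (P.f x₂.toList) s₂.toList) :
    P.f x₁.toList = P.f x₂.toList := by
  obtain ⟨eh, eg, ev, -, -⟩ := P.fields_eq_of_squery_eq hb hi he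
  rw [GoodS, hl₁, eh, eg] at hg₁
  rw [GoodS, hl₂] at hg₂
  obtain ⟨r₁, hw₁, hf₁⟩ := P.exists_witSet_eq_singleton hg₁
  obtain ⟨r₂, hw₂, hf₂⟩ := P.exists_witSet_eq_singleton hg₂
  rw [eh] at ev
  have hws : witSet P n b (P.f x₁.toList) (s₂.toList.take (P.Lh n)) ((s₂.toList.drop (P.Lh n)).take (Lg n)) =
      witSet P n b (P.f x₂.toList) (s₂.toList.take (P.Lh n)) ((s₂.toList.drop (P.Lh n)).take (Lg n)) := by
    unfold witSet
    congr 1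
    ext r
    rw [ev]
  rw [hws, hw₂] at hw₁
  have h12 : r₂ = r₁ := by
    have := mem_singleton_self r₂
    rw [hw₁, mem_singleton] at this
    exact this
  rw [← hf₁, ← hf₂, h12]

/-- **Per-query domination bound**: for a fixed query string `z`,
`2 · Σ_{x : level b} #{s : good ∧ z_{b,i}(x, s) = z} ≤ 2^b · 2^{free}` — all contributors lie in one
set `S_{x₁}` of size `≤ 2^{b-1}` (`f_eq_of_squery_eq`, `two_mul_card_Sx_le`) and each contributes at
most a fibre (`card_filter_squery_eq_le`). [Bogdanov–Trevisan 2006, §5.1.3 (Domination) with Claim 28]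
[cite: BogdanovTrevisan2006, Thm. 29 (ECCC TR06-073 §5.1.3, Domination)] -/
theorem two_mul_sum_card_le {b i : ℕ} (hb : b ≤ n + 2) (hi : i < n) (z : List Bool) :
    2 * ∑ x ∈ univ.filter (fun x : List.Vector Bool n => P.lvl x = b),
        (univ.filter fun s : List.Vector Bool (P.Dn n) =>
          P.GoodS x s.toList ∧ P.squery n b i (P.f x.toList) s.toList = z).card ≤ 2 ^ b * 2 ^ free n b i := by
  set cnt : List.Vector Bool n → ℕ := fun x => (univ.filter fun s : List.Vector Bool (P.Dn n) =>
      P.GoodS x s.toList ∧ P.squery n b i (P.f x.toList) s.toList = z).card with hcnt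
  set C := univ.filter fun x : List.Vector Bool n => P.lvl x = b ∧ cnt x ≠ 0 with hC
  -- restrict the sum to the contributors
  have hsum : ∑ x ∈ univ.filter (fun x : List.Vector Bool n => P.lvl x = b), cnt x = ∑ x ∈ C, cnt x := by
    rw [hC]
    symm
    refine sum_subset (fun x hx => mem_filter.2 ⟨mem_univ _, (mem_filter.1 hx).2.1⟩) fun x hx hxC => ?_
    by_contra hne
    exact hxC (mem_filter.2 ⟨mem_univ _, (mem_filter.1 hx).2, hne⟩)
  -- each contributor contributes at most a fibre
  have hle : ∀ x, cnt x ≤ 2 ^ free n b i := fun x =>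
    (card_le_card (fun s hs => mem_filter.2 ⟨mem_univ _, (mem_filter.1 hs).2.2⟩)).trans
      (P.card_filter_squery_eq_le hb hi _ z)
  -- the contributors share their image, hence `|C| ≤ |S_{x₁}| ≤ 2^b / 2`
  have hCcard : 2 * C.card ≤ 2 ^ b := by
    rcases C.eq_empty_or_nonempty with h0 | ⟨x₁, hx₁⟩
    · rw [h0, card_empty]; exact Nat.zero_le _
    have hx₁' := mem_filter.1 hx₁
    have hsub : C ⊆ P.Sx x₁ := by
      intro x hx
      have hx' := mem_filter.1 hx
      obtain ⟨s, hs⟩ := card_ne_zero.1 hx'.2.2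
      obtain ⟨s₁, hs₁⟩ := card_ne_zero.1 hx₁'.2.2
      have hs' := (mem_filter.1 hs).2
      have hs₁' := (mem_filter.1 hs₁).2
      simp only [Sx, mem_filter, mem_univ, true_and]
      exact P.f_eq_of_squery_eq hb hi hx'.2.1 hx₁'.2.1 hs'.1 hs₁'.1 (hs'.2.trans hs₁'.2.symm)
    calc 2 * C.card ≤ 2 * (P.Sx x₁).card := Nat.mul_le_mul_left _ (card_le_card hsub)
      _ ≤ 2 ^ P.lvl x₁ := P.two_mul_card_Sx_le x₁
      _ = 2 ^ b := by rw [hx₁'.2.1]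
  change 2 * ∑ x ∈ univ.filter (fun x : List.Vector Bool n => P.lvl x = b), cnt x ≤ _
  rw [hsum]
  calc 2 * ∑ x ∈ C, cnt x ≤ 2 * ∑ x ∈ C, 2 ^ free n b i := Nat.mul_le_mul_left _ (sum_le_sum fun x _ => hle x)
    _ = 2 * C.card * 2 ^ free n b i := by rw [sum_const, smul_eq_mul, Nat.mul_assoc]
    _ ≤ 2 ^ b * 2 ^ free n b i := Nat.mul_le_mul_right _ hCcard

/-- The exponent bookkeeping: `N(n,b,i) + b + free(n,b,i) = D(n) + n + 4`. [folklore] -/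
theorem Nlen_add_free {b i : ℕ} (hb : b ≤ n + 2) (hi : i < n) : P.Nlen n b i + b + free n b i = P.Dn n + (n + 4) := by
  have hJ := Jn_le_Jpool hb hi
  unfold Nlen free Dn W
  omega

/-- The query of `x` on seeds `s`, as an `N(n,b,i)`-bit vector. [folklore] -/
def squeryV {b i : ℕ} (hb : b ≤ n + 2) (hi : i < n) (x : List.Vector Bool n) (s : List.Vector Bool (P.Dn n)) :
    List.Vector Bool (P.Nlen n b i) :=
  ⟨P.squery n b i (P.f x.toList) s.toList, P.length_squery hb hi _ s⟩

/-- **Domination of the good part of the query distribution** (B–T Thm. 29, "Domination", with the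
disjointness of Claim 28): for every query index `(b, i)` and every set `F` of instances,
`Σ_{x : level b} #{seeds : good ∧ z_{b,i} ∈ F} ≤ 8 · 2^{n + D(n)} · U_{N(n,b,i)}(F)`.
[Bogdanov–Trevisan 2006, §5.1.3 (Domination) and Claim 28 (`D_n(B) ≤ Σ_{x∈B} q₂(n) D'(V_x) ≤ …`)]
[cite: BogdanovTrevisan2006, Thm. 29 (ECCC TR06-073 §5.1.3, Domination)] -/
theorem sum_card_good_and_mem_le {b i : ℕ} (hb : b ≤ n + 2) (hi : i < n) (F : Set (List Bool)) :
    ((∑ x ∈ univ.filter (fun x : List.Vector Bool n => P.lvl x = b),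
        (univ.filter fun s : List.Vector Bool (P.Dn n) =>
          P.GoodS x s.toList ∧ P.squery n b i (P.f x.toList) s.toList ∈ F).card : ℕ) : ℝ) ≤
      8 * 2 ^ (n + P.Dn n) * uniformProb (P.Nlen n b i) F := by
  set Fz : Finset (List.Vector Bool (P.Nlen n b i)) := univ.filter fun z => z.toList ∈ F with hFz
  -- fibrewise decomposition along `s ↦ z_{b,i}(x, s)`
  have hfib : ∀ x : List.Vector Bool n,
      (univ.filter fun s : List.Vector Bool (P.Dn n) =>
          P.GoodS x s.toList ∧ P.squery n b i (P.f x.toList) s.toList ∈ F).card =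
        ∑ z ∈ Fz, (univ.filter fun s : List.Vector Bool (P.Dn n) =>
          P.GoodS x s.toList ∧ P.squery n b i (P.f x.toList) s.toList = z.toList).card := by
    intro x
    rw [card_eq_sum_card_fiberwise (f := P.squeryV hb hi x) (t := Fz)
      (fun s hs => mem_filter.2 ⟨mem_univ _, (mem_filter.1 hs).2.2⟩)]
    refine sum_congr rfl fun z hz => ?_
    congr 1
    ext s
    simp only [mem_filter, mem_univ, true_and]
    constructor
    · rintro ⟨⟨hg, -⟩, hz'⟩
      exact ⟨hg, by rw [← hz']; rfl⟩
    · rintro ⟨hg, hz'⟩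
      refine ⟨⟨hg, ?_⟩, ?_⟩
      · rw [hz']; exact (mem_filter.1 hz).2
      · exact List.Vector.toList_injective hz'
  have hswap : ∑ x ∈ univ.filter (fun x : List.Vector Bool n => P.lvl x = b),
      (univ.filter fun s : List.Vector Bool (P.Dn n) =>
          P.GoodS x s.toList ∧ P.squery n b i (P.f x.toList) s.toList ∈ F).card =
      ∑ z ∈ Fz, ∑ x ∈ univ.filter (fun x : List.Vector Bool n => P.lvl x = b),
        (univ.filter fun s : List.Vector Bool (P.Dn n) =>
          P.GoodS x s.toList ∧ P.squery n b i (P.f x.toList) s.toList = z.toList).card := by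
    rw [sum_congr rfl fun x _ => hfib x, sum_comm]
  have hnat : 2 * ∑ x ∈ univ.filter (fun x : List.Vector Bool n => P.lvl x = b),
      (univ.filter fun s : List.Vector Bool (P.Dn n) =>
          P.GoodS x s.toList ∧ P.squery n b i (P.f x.toList) s.toList ∈ F).card ≤ Fz.card * (2 ^ b * 2 ^ free n b i) := by
    rw [hswap, mul_sum]
    calc _ ≤ ∑ z ∈ Fz, 2 ^ b * 2 ^ free n b i := sum_le_sum fun z _ => P.two_mul_sum_card_le hb hi z.toList
      _ = _ := by rw [sum_const, smul_eq_mul]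
  -- pass to the reals: `|Fz| = U_N(F) · 2^N` and `2^N · 2^b · 2^free = 16 · 2^{n + Dn}`
  have hU : uniformProb (P.Nlen n b i) F = (Fz.card : ℝ) / 2 ^ P.Nlen n b i := by
    rw [uniformProb, hFz]
  have hexp : (2 : ℝ) ^ P.Nlen n b i * (2 ^ b * 2 ^ free n b i) = 16 * 2 ^ (n + P.Dn n) := by
    rw [← pow_add, ← pow_add, show P.Nlen n b i + (b + free n b i) = (n + P.Dn n) + 4 by
      have := P.Nlen_add_free hb hi; omega, pow_add]
    norm_num [mul_comm]
  have hnat' : (2 : ℝ) * (∑ x ∈ univ.filter (fun x : List.Vector Bool n => P.lvl x = b),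
      (univ.filter fun s : List.Vector Bool (P.Dn n) =>
          P.GoodS x s.toList ∧ P.squery n b i (P.f x.toList) s.toList ∈ F).card : ℕ) ≤
        (Fz.card : ℝ) * (2 ^ b * 2 ^ free n b i) := by exact_mod_cast hnat
  rw [hU]
  have h2N : (0 : ℝ) < 2 ^ P.Nlen n b i := by positivity
  rw [show (8 : ℝ) * 2 ^ (n + P.Dn n) * (Fz.card / 2 ^ P.Nlen n b i) =
      Fz.card * (16 * 2 ^ (n + P.Dn n)) / 2 ^ P.Nlen n b i / 2 by ring, ← hexp,
    le_div_iff₀ (by norm_num : (0:ℝ) < 2), le_div_iff₀ h2N]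
  calc _ = (2 : ℝ) * (∑ x ∈ univ.filter (fun x : List.Vector Bool n => P.lvl x = b),
        (univ.filter fun s : List.Vector Bool (P.Dn n) =>
          P.GoodS x s.toList ∧ P.squery n b i (P.f x.toList) s.toList ∈ F).card : ℕ) * 2 ^ P.Nlen n b i := by
        push_cast; ring
    _ ≤ (Fz.card : ℝ) * (2 ^ b * 2 ^ free n b i) * 2 ^ P.Nlen n b i := by
        exact mul_le_mul_of_nonneg_right hnat' h2N.le
    _ = _ := by ring

end Domination

/-! ### Step 3: amplification -/

section Amplification

variable {n : ℕ} (Ad : Adv)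

/-- `#true + #false = length` for Boolean lists. [folklore] -/
theorem count_true_add_count_false (l : List Bool) : l.count true + l.count false = l.length := by
  induction l with
  | nil => rfl
  | cons b l ih => cases b <;> simp <;> omega

/-- Negation swaps the counts: `#true(¬l) = #false(l)`. [folklore] -/
theorem count_true_map_not (l : List Bool) : (l.map (!·)).count true = l.count false := by
  induction l with
  | nil => rfl
  | cons b l ih => cases b <;> simp [ih]

/-- A wrong majority verdict is a failed majority of the correctness bits: if `maj l ≠ c` then the
strict majority of `[b == c]_{b ∈ l}` fails. [folklore] -/
theorem maj_map_beq_eq_false {l : List Bool} {c : Bool} (h : maj l ≠ c) : maj (l.map (· == c)) = false := by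
  cases c
  · -- `c = false`: the correctness bits are the negations
    have hm : maj l = true := by cases h' : maj l <;> simp_all
    simp only [maj, decide_eq_true_eq] at hm
    have hneg : l.map (· == false) = l.map (!·) := by congr 1; funext b; cases b <;> rfl
    rw [hneg]
    simp only [maj, decide_eq_false_iff_not, not_lt, List.length_map, count_true_map_not]
    have := count_true_add_count_false l
    omega
  · -- `c = true`: the correctness bits are the bits
    have hm : maj l = false := by cases h' : maj l <;> simp_all
    have hid : l.map (· == true) = l := by
      conv_rhs => rw [← List.map_id l]
      congr 1; funext b; cases b <;> rfl
    rw [hid, hm]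

/-- The coin length of `A` on every query at `n` is `coinLen_A(s(n))`. [folklore] -/
theorem coinLen_query {b i : ℕ} (hb : b ≤ n + 2) (hi : i < n) {z : List Bool} (hz : z.length = P.Nlen n b i) :
    Ad.A.coinLen (schemeEnc (z, P.Nlen n b i, P.mOf n b i)).length = Ad.A.coinLen (P.slen n) := by
  rw [P.length_schemeEnc_query hb hi hz]

/-- **A good query is answered correctly by `3/4` of the coin strings**: if `Pr_ρ[A(z) ≠ c] < 1/4`
then `3 · 2^κ ≤ 4 · #{ρ ∈ {0,1}^κ : A(z; ρ) = c}`. [Bogdanov–Trevisan 2006, Def. 2.12] [folklore] -/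
theorem card_correct_ge {b i κ : ℕ} (hb : b ≤ n + 2) (hi : i < n) {z : List Bool} (hz : z.length = P.Nlen n b i)
    (hκ : Ad.A.coinLen (P.slen n) = κ) (c : Bool)
    (hgood : Ad.A.pr schemeEnc (z, P.Nlen n b i, P.mOf n b i) {c' | c' ≠ c} < 1 / 4) :
    3 * 2 ^ κ ≤ 4 * (univ.filter fun ρ : List.Vector Bool κ =>
      (Ad.A.run (z, P.Nlen n b i, P.mOf n b i) ρ.toList == c) = true).card := by
  set W := univ.filter fun ρ : List.Vector Bool κ => Ad.A.run (z, P.Nlen n b i, P.mOf n b i) ρ.toList ≠ c with hW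
  have hpr := hgood
  rw [RandAlg.pr_eq_uniformProb, P.coinLen_query Ad hb hi hz, hκ] at hpr
  have hWlt : (W.card : ℝ) / 2 ^ κ < 1 / 4 := by
    have h' : uniformProb κ {y : List Bool | Ad.A.run (z, P.Nlen n b i, P.mOf n b i) y ∈ {c' : Bool | c' ≠ c}} =
        (W.card : ℝ) / 2 ^ κ := by
      rw [uniformProb]
      congr 3
      ext ρ
      simp [hW]
    rw [← h']
    exact hpr
  rw [div_lt_iff₀ (by positivity)] at hWlt
  have h4W : 4 * W.card < 2 ^ κ := by
    have : (4 : ℝ) * W.card < 2 ^ κ := by linarith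
    exact_mod_cast this
  have hsplit : W.card + (univ.filter fun ρ : List.Vector Bool κ =>
      (Ad.A.run (z, P.Nlen n b i, P.mOf n b i) ρ.toList == c) = true).card = 2 ^ κ := by
    have h := Finset.card_filter_add_card_filter_not (s := (univ : Finset (List.Vector Bool κ)))
      (fun ρ : List.Vector Bool κ => Ad.A.run (z, P.Nlen n b i, P.mOf n b i) ρ.toList ≠ c)
    rw [card_univ, card_vector, Fintype.card_bool] at h
    rw [hW, ← h]
    congr 2
    ext ρ
    simp
  omega

/-- **Amplification: a good query is answered wrongly by at most a `1/(32n)` fraction of the coin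
strings of a round** (`128 n` independent runs, Chebyshev: `card_maj_fail_le`; the runs read the
consecutive `κ`-blocks of the `i`-th segment of length `128 n κ`, a uniform window of the coins).
[Bogdanov–Trevisan 2006, Def. 2.12 (remark: amplification of the constant `1/4`); proof of Claim 28]
[cite: BogdanovTrevisan2006, Claim 28 (ECCC TR06-073 §5.1.1)] -/
theorem card_answer_ne_le {b i κ : ℕ} (hb : b ≤ n + 2) (hi : i < n) (hn : 0 < n) {z : List Bool}
    (hz : z.length = P.Nlen n b i) (hκ : Ad.A.coinLen (P.slen n) = κ) (hκQ : κ ≤ P.Q Ad n) (c : Bool)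
    (hgood : Ad.A.pr schemeEnc (z, P.Nlen n b i, P.mOf n b i) {c' | c' ≠ c} < 1 / 4) :
    ((univ.filter fun ac : List.Vector Bool (P.Cn Ad n) => P.answer Ad n b i κ z ac.toList ≠ c).card : ℝ) ≤
      1 / (32 * n) * 2 ^ P.Cn Ad n := by
  set q := (z, P.Nlen n b i, P.mOf n b i) with hq
  set g : List Bool → Bool := fun ρ => Ad.A.run q ρ == c with hg
  set L := κ * Tm n with hL
  -- the `i`-th segment fits: `Cn = i L + (L + post)`
  have hfit : (i + 1) * L ≤ P.Cn Ad n := by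
    unfold Cn; rw [hL]
    calc (i + 1) * (κ * Tm n) ≤ n * (P.Q Ad n * Tm n) := Nat.mul_le_mul hi (Nat.mul_le_mul_right _ hκQ)
      _ = P.Q Ad n * Tm n * n := by ring
  obtain ⟨post, hpost⟩ : ∃ post, P.Cn Ad n = i * L + (L + post) :=
    ⟨P.Cn Ad n - (i * L + L), by
      have h := hfit
      rw [Nat.add_mul, one_mul] at h
      generalize i * L = iL at h ⊢
      omega⟩
  -- a wrong answer is a failed majority of correctness bits on the window
  have hsub : (univ.filter fun ac : List.Vector Bool (P.Cn Ad n) => P.answer Ad n b i κ z ac.toList ≠ c) ⊆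
      univ.filter fun ac : List.Vector Bool (P.Cn Ad n) =>
        maj ((List.range (Tm n)).map fun t => g (seg κ t ((ac.toList.drop (i * L)).take L))) = false := by
    intro ac hac
    have hw := (mem_filter.1 hac).2
    refine mem_filter.2 ⟨mem_univ _, ?_⟩
    have := maj_map_beq_eq_false hw
    rw [List.map_map] at this
    exact this
  have hwin := card_filter_window (i * L) L post (fun σ => maj ((List.range (Tm n)).map fun t => g (seg κ t σ)) = false)
  have hmaj : ((univ.filter fun σ : List.Vector Bool L =>
      maj ((List.range (Tm n)).map fun t => g (seg κ t σ.toList)) = false).card : ℝ) ≤ 1 / (32 * n) * 2 ^ L := by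
    rw [hL]
    refine card_maj_fail_le g (by positivity) ?_ (P.card_correct_ge Ad hb hi hz hκ c hgood)
    unfold Tm
    rw [div_div_eq_mul_div]
    have hn' : (0 : ℝ) < n := by exact_mod_cast hn
    rw [div_le_iff₀ (by positivity)]
    push_cast
    nlinarith
  calc ((univ.filter fun ac : List.Vector Bool (P.Cn Ad n) => P.answer Ad n b i κ z ac.toList ≠ c).card : ℝ)
      ≤ (univ.filter fun ac : List.Vector Bool (P.Cn Ad n) =>
          maj ((List.range (Tm n)).map fun t => g (seg κ t ((ac.toList.drop (i * L)).take L))) = false).card := by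
        exact_mod_cast card_le_card hsub
    _ = 2 ^ (i * L) * ((univ.filter fun σ : List.Vector Bool L =>
          maj ((List.range (Tm n)).map fun t => g (seg κ t σ.toList)) = false).card * 2 ^ post) := by
        rw [Yao.card_filter_vector_congr hpost (fun ac =>
          maj ((List.range (Tm n)).map fun t => g (seg κ t ((ac.drop (i * L)).take L))) = false)]
        exact_mod_cast hwin
    _ ≤ 2 ^ (i * L) * (1 / (32 * n) * 2 ^ L * 2 ^ post) := by
        gcongr
    _ = 1 / (32 * n) * 2 ^ P.Cn Ad n := by rw [hpost, pow_add, pow_add]; ring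

end Amplification

/-! ### Step 4: assembly -/

section Assembly

variable {n : ℕ} (Ad : Adv)

/-- **The bad instances** of the scheme `A` for a language `L` at parameters `(N, m)`: those on which
`A(z; 1^N, 1^m)` errs with probability `≥ 1/4` over its coins (Bogdanov–Trevisan Def. 2.12; the set
`F` of the proof of Claim 28). [Bogdanov–Trevisan 2006, Def. 2.12 and proof of Claim 28]
[cite: BogdanovTrevisan2006, Def. 2.12 (ECCC TR06-073 §2, with Claim 28)] -/
def Bad (L : Language Bool) (N m : ℕ) : Set (List Bool) :=
  {z | (1 / 4 : ℝ) ≤ Ad.A.pr schemeEnc (z, N, m) {c | c ≠ L.boolIndicator z}}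

/-- **Good queries**: none of the `n` queries of `x` (at its level) on the seeds `s` is bad. [folklore] -/
def GoodQ (x : List.Vector Bool n) (s : List Bool) : Prop :=
  ∀ i < n, P.squery n (P.lvl x) i (P.f x.toList) s ∉ Bad Ad P.Lang (P.Nlen n (P.lvl x) i) (P.mOf n (P.lvl x) i)

/-- **All answers correct**: every majority answer equals the membership bit of its query. [folklore] -/
def AllCorrect (κ : ℕ) (x : List.Vector Bool n) (s ac : List Bool) : Prop :=
  ∀ i < n, P.answer Ad n (P.lvl x) i κ (P.squery n (P.lvl x) i (P.f x.toList) s) ac =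
    P.Lang.boolIndicator (P.squery n (P.lvl x) i (P.f x.toList) s)

/-- Reading a list back bit by bit: `[l[0], …, l[|l|-1]] = l`. [folklore] -/
theorem map_getD_range (l : List Bool) : (List.range l.length).map (fun i => l.getD i false) = l := by
  apply List.ext_getElem (by simp)
  intro i h1 h2
  simp only [List.getElem_map, List.getElem_range, List.getD_eq_getElem?_getD, List.getElem?_eq_getElem h2,
    Option.getD_some]

/-- **Good seeds with correct answers hit**: the candidate of the round at the level of `x` is the
isolated witness `r₀`, a preimage of `f x`. [Bogdanov–Trevisan 2006, Thm. 21 ("the sequence of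
oracle answers … allows the search algorithm to recover all the bits of the unique witness")]
[cite: BogdanovTrevisan2006, Thm. 21 (ECCC TR06-073 §3.2)] -/
theorem f_cand_eq {κ : ℕ} (x : List.Vector Bool n) (s : List.Vector Bool (P.Dn n)) (ac : List Bool)
    (hgood : P.GoodS x s.toList) (hall : P.AllCorrect Ad κ x s.toList ac) :
    P.f (P.cand Ad n (P.lvl x) κ (P.f x.toList) (s.toList ++ ac)) = P.f x.toList := by
  obtain ⟨l1, l2, l3, l4⟩ := P.length_fields₀ s
  obtain ⟨r₀, hw, hf₀⟩ := P.exists_witSet_eq_singleton hgood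
  have hcand : P.cand Ad n (P.lvl x) κ (P.f x.toList) (s.toList ++ ac) = r₀.toList := by
    unfold cand
    rw [List.take_left' s.toList_length, List.drop_left' s.toList_length]
    conv_rhs => rw [← map_getD_range r₀.toList, r₀.toList_length]
    refine List.map_congr_left fun i hi => ?_
    rw [List.mem_range] at hi
    rw [hall i hi]
    have hiff := mem_Lang_iff_of_isolated (y := P.f x.toList) l1 l2 l3 l4 (P.lvl_le x) hi hw
    change P.Lang.boolIndicator (P.squery n (P.lvl x) i (P.f x.toList) s.toList) = _
    unfold squery
    unfold Set.boolIndicator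
    split_ifs with hz
    · exact (hiff.1 hz).symm
    · cases h : r₀.toList.getD i false
      · rfl
      · exact absurd (hiff.2 h) hz
  rw [hcand, hf₀]

/-- **All answers are correct outside a `1/32` fraction of the coins** (on good queries): union
bound over the `n` queries of `card_answer_ne_le`. [Bogdanov–Trevisan 2006, proof of Claim 28]
[cite: BogdanovTrevisan2006, Claim 28 (ECCC TR06-073 §5.1.1)] -/
theorem card_not_allCorrect_le {κ : ℕ} (hn : 0 < n) (hκ : Ad.A.coinLen (P.slen n) = κ) (hκQ : κ ≤ P.Q Ad n)
    (x : List.Vector Bool n) (s : List.Vector Bool (P.Dn n)) (hq : P.GoodQ Ad x s.toList) :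
    ((univ.filter fun ac : List.Vector Bool (P.Cn Ad n) => ¬ P.AllCorrect Ad κ x s.toList ac.toList).card : ℝ) ≤
      1 / 32 * 2 ^ P.Cn Ad n := by
  have hb := P.lvl_le x
  have hsub : (univ.filter fun ac : List.Vector Bool (P.Cn Ad n) => ¬ P.AllCorrect Ad κ x s.toList ac.toList) ⊆
      (range n).biUnion fun i => univ.filter fun ac : List.Vector Bool (P.Cn Ad n) =>
        P.answer Ad n (P.lvl x) i κ (P.squery n (P.lvl x) i (P.f x.toList) s.toList) ac.toList ≠
          P.Lang.boolIndicator (P.squery n (P.lvl x) i (P.f x.toList) s.toList) := by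
    intro ac hac
    have h := (mem_filter.1 hac).2
    simp only [AllCorrect, not_forall, exists_prop] at h
    obtain ⟨i, hi, hne⟩ := h
    exact mem_biUnion.2 ⟨i, mem_range.2 hi, mem_filter.2 ⟨mem_univ _, hne⟩⟩
  have hn' : (0 : ℝ) < n := by exact_mod_cast hn
  calc ((univ.filter fun ac : List.Vector Bool (P.Cn Ad n) => ¬ P.AllCorrect Ad κ x s.toList ac.toList).card : ℝ)
      ≤ ∑ i ∈ range n, ((univ.filter fun ac : List.Vector Bool (P.Cn Ad n) =>
          P.answer Ad n (P.lvl x) i κ (P.squery n (P.lvl x) i (P.f x.toList) s.toList) ac.toList ≠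
            P.Lang.boolIndicator (P.squery n (P.lvl x) i (P.f x.toList) s.toList)).card : ℝ) := by
        exact_mod_cast (card_le_card hsub).trans card_biUnion_le
    _ ≤ ∑ i ∈ range n, (1 / (32 * n) * 2 ^ P.Cn Ad n : ℝ) := by
        refine sum_le_sum fun i hi => ?_
        rw [mem_range] at hi
        refine P.card_answer_ne_le Ad hb hi hn (P.length_squery hb hi _ s) hκ hκQ _ ?_
        have h := hq i hi
        simp only [Bad, Set.mem_setOf_eq, not_le] at h
        exact h
    _ = 1 / 32 * 2 ^ P.Cn Ad n := by
        rw [sum_const, card_range, nsmul_eq_mul]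
        field_simp

/-- **Hits of a round, per `x`**: the round at the level of `x` with the true coin length hits on at
least `(31/32) · 2^{C(n)}` coin strings for every good seed string with good queries.
[Bogdanov–Trevisan 2006, proof of Claim 28 ("If `x ∉ B`, then … `A'(y_i; …)` is an `L'`-witness with
constant probability")] [cite: BogdanovTrevisan2006, Claim 28 (ECCC TR06-073 §5.1.1)] -/
theorem card_hit_ge {κ : ℕ} (hn : 0 < n) (hκ : Ad.A.coinLen (P.slen n) = κ) (hκQ : κ ≤ P.Q Ad n) (x : List.Vector Bool n) :
    ((univ.filter fun s : List.Vector Bool (P.Dn n) => P.GoodS x s.toList ∧ P.GoodQ Ad x s.toList).card : ℝ) *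
        (31 / 32 * 2 ^ P.Cn Ad n) ≤
      (univ.filter fun sd : List.Vector Bool (P.Dn n + P.Cn Ad n) =>
        P.f (P.cand Ad n (P.lvl x) κ (P.f x.toList) sd.toList) = P.f x.toList).card := by
  -- hits contain (good seeds, all-correct coins)
  have h1 := Yao.sum_card_filter_eq_card (P.Dn n) (P.Cn Ad n)
    (fun s ac => P.GoodS x s ∧ P.GoodQ Ad x s ∧ P.AllCorrect Ad κ x s ac)
  have h2 : (univ.filter fun v : List.Vector Bool (P.Dn n + P.Cn Ad n) =>
      P.GoodS x (v.toList.take (P.Dn n)) ∧ P.GoodQ Ad x (v.toList.take (P.Dn n)) ∧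
        P.AllCorrect Ad κ x (v.toList.take (P.Dn n)) (v.toList.drop (P.Dn n))).card ≤
      (univ.filter fun sd : List.Vector Bool (P.Dn n + P.Cn Ad n) =>
        P.f (P.cand Ad n (P.lvl x) κ (P.f x.toList) sd.toList) = P.f x.toList).card := by
    refine card_le_card fun v hv => mem_filter.2 ⟨mem_univ _, ?_⟩
    obtain ⟨hg, -, hall⟩ := (mem_filter.1 hv).2
    have hs : (v.toList.take (P.Dn n)).length = P.Dn n := by
      rw [List.length_take, v.toList_length]; exact Nat.min_eq_left (Nat.le_add_right _ _)
    have h := P.f_cand_eq Ad x ⟨v.toList.take (P.Dn n), hs⟩ (v.toList.drop (P.Dn n)) hg hall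
    simp only [List.Vector.toList_mk, List.take_append_drop] at h
    exact h
  -- per good seed, the all-correct coins are most of them
  have h3 : ∀ s : List.Vector Bool (P.Dn n), P.GoodS x s.toList ∧ P.GoodQ Ad x s.toList →
      (31 / 32 * 2 ^ P.Cn Ad n : ℝ) ≤ (univ.filter fun ac : List.Vector Bool (P.Cn Ad n) =>
        P.GoodS x s.toList ∧ P.GoodQ Ad x s.toList ∧ P.AllCorrect Ad κ x s.toList ac.toList).card := by
    rintro s ⟨hg, hq⟩
    have hbad := P.card_not_allCorrect_le Ad hn hκ hκQ x s hq
    have hsplit := Finset.card_filter_add_card_filter_not (s := (univ : Finset (List.Vector Bool (P.Cn Ad n))))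
      (fun ac => P.AllCorrect Ad κ x s.toList ac.toList)
    rw [card_univ, card_vector, Fintype.card_bool] at hsplit
    have hsplit' : ((univ.filter fun ac : List.Vector Bool (P.Cn Ad n) => P.AllCorrect Ad κ x s.toList ac.toList).card : ℝ) +
        (univ.filter fun ac : List.Vector Bool (P.Cn Ad n) => ¬ P.AllCorrect Ad κ x s.toList ac.toList).card = 2 ^ P.Cn Ad n := by
      exact_mod_cast hsplit
    have heq : (univ.filter fun ac : List.Vector Bool (P.Cn Ad n) =>
        P.GoodS x s.toList ∧ P.GoodQ Ad x s.toList ∧ P.AllCorrect Ad κ x s.toList ac.toList) =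
        univ.filter fun ac : List.Vector Bool (P.Cn Ad n) => P.AllCorrect Ad κ x s.toList ac.toList := by
      ext ac; simp [hg, hq]
    rw [heq]
    linarith
  -- sum over seeds
  have h4 : ((univ.filter fun s : List.Vector Bool (P.Dn n) => P.GoodS x s.toList ∧ P.GoodQ Ad x s.toList).card : ℝ) *
      (31 / 32 * 2 ^ P.Cn Ad n) ≤ ∑ s : List.Vector Bool (P.Dn n), ((univ.filter fun ac : List.Vector Bool (P.Cn Ad n) =>
        P.GoodS x s.toList ∧ P.GoodQ Ad x s.toList ∧ P.AllCorrect Ad κ x s.toList ac.toList).card : ℝ) := by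
    rw [card_eq_sum_ones, Nat.cast_sum, sum_mul, ← sum_filter_add_sum_filter_not univ
      (fun s : List.Vector Bool (P.Dn n) => P.GoodS x s.toList ∧ P.GoodQ Ad x s.toList)
      (fun s => ((univ.filter fun ac : List.Vector Bool (P.Cn Ad n) =>
        P.GoodS x s.toList ∧ P.GoodQ Ad x s.toList ∧ P.AllCorrect Ad κ x s.toList ac.toList).card : ℝ))]
    have hnonneg : (0 : ℝ) ≤ ∑ s ∈ univ.filter (fun s : List.Vector Bool (P.Dn n) => ¬ (P.GoodS x s.toList ∧ P.GoodQ Ad x s.toList)),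
        ((univ.filter fun ac : List.Vector Bool (P.Cn Ad n) =>
          P.GoodS x s.toList ∧ P.GoodQ Ad x s.toList ∧ P.AllCorrect Ad κ x s.toList ac.toList).card : ℝ) :=
      sum_nonneg fun _ _ => by positivity
    have hmain : ∑ s ∈ univ.filter (fun s : List.Vector Bool (P.Dn n) => P.GoodS x s.toList ∧ P.GoodQ Ad x s.toList),
        ((1 : ℕ) : ℝ) * (31 / 32 * 2 ^ P.Cn Ad n) ≤
        ∑ s ∈ univ.filter (fun s : List.Vector Bool (P.Dn n) => P.GoodS x s.toList ∧ P.GoodQ Ad x s.toList),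
          ((univ.filter fun ac : List.Vector Bool (P.Cn Ad n) =>
            P.GoodS x s.toList ∧ P.GoodQ Ad x s.toList ∧ P.AllCorrect Ad κ x s.toList ac.toList).card : ℝ) :=
      sum_le_sum fun s hs => by rw [Nat.cast_one, one_mul]; exact h3 s (mem_filter.1 hs).2
    linarith
  calc _ ≤ _ := h4
    _ = ((univ.filter fun v : List.Vector Bool (P.Dn n + P.Cn Ad n) =>
          P.GoodS x (v.toList.take (P.Dn n)) ∧ P.GoodQ Ad x (v.toList.take (P.Dn n)) ∧
            P.AllCorrect Ad κ x (v.toList.take (P.Dn n)) (v.toList.drop (P.Dn n))).card : ℝ) := by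
        rw [← Nat.cast_sum]; exact_mod_cast h1
    _ ≤ _ := by exact_mod_cast h2

/-- **Good seeds are at least `1/16` of all seed strings** (from the key-pair density
`sixteen_mul_card_good_ge`; the pad and junk bits are unconstrained). [Bogdanov–Trevisan 2006,
§5.1.3 (Density)] [cite: BogdanovTrevisan2006, Thm. 29 (ECCC TR06-073 §5.1.3, Density)] -/
theorem card_goodS_ge (hP : ∀ x, (P.f x).length ≤ P.p.eval x.length) (x : List.Vector Bool n) :
    2 ^ P.Dn n ≤ 16 * (univ.filter fun s : List.Vector Bool (P.Dn n) => P.GoodS x s.toList).card := by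
  have hD : P.Dn n = (P.Lh n + Lg n) + ((n + 4) + Jpool n) := by unfold Dn; omega
  rw [Yao.card_filter_vector_congr hD (fun l => P.GoodS x l)]
  have hcongr : (univ.filter fun v : List.Vector Bool ((P.Lh n + Lg n) + ((n + 4) + Jpool n)) => P.GoodS x v.toList) =
      univ.filter fun v : List.Vector Bool ((P.Lh n + Lg n) + ((n + 4) + Jpool n)) =>
        P.Good (P.lvl x) x ((v.toList.take (P.Lh n + Lg n)).take (P.Lh n)) ((v.toList.take (P.Lh n + Lg n)).drop (P.Lh n)) := by
    congr 1
    ext v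
    have hv := v.toList_length
    have hl : (v.toList.take (P.Lh n)).length = P.Lh n := by rw [List.length_take, hv]; omega
    rw [GoodS, List.take_add, List.take_left' hl, List.drop_left' hl]
  rw [hcongr]
  have h := card_filter_take (P.Lh n + Lg n) ((n + 4) + Jpool n)
    (fun w => P.Good (P.lvl x) x (w.take (P.Lh n)) (w.drop (P.Lh n)))
  rw [show (univ.filter fun v : List.Vector Bool ((P.Lh n + Lg n) + ((n + 4) + Jpool n)) =>
      P.Good (P.lvl x) x ((v.toList.take (P.Lh n + Lg n)).take (P.Lh n)) ((v.toList.take (P.Lh n + Lg n)).drop (P.Lh n))).card =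
      (univ.filter fun w : List.Vector Bool (P.Lh n + Lg n) => P.Good (P.lvl x) x (w.toList.take (P.Lh n)) (w.toList.drop (P.Lh n))).card *
        2 ^ ((n + 4) + Jpool n) by convert h using 3]
  have hg := P.sixteen_mul_card_good_ge hP x
  rw [hD, pow_add]
  nlinarith [Nat.two_pow_pos ((n + 4) + Jpool n)]

/-- **Bad queries are rare on good seeds**: summed over `x`, the seed strings that are good for `x` but
produce some bad query number at most `2^{n + D(n)}/32` — union bound over the query index, level
by level, from the domination bound `sum_card_good_and_mem_le` and the heuristic scheme's guarantee
`U_N(Bad) ≤ 1/m ≤ 1/m₀`, `m₀ = 256 n (n+3)`. [Bogdanov–Trevisan 2006, proof of Claim 28 ("Observe that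
`D_n(B)` is small")] [cite: BogdanovTrevisan2006, Claim 28 (ECCC TR06-073 §5.1.1)] -/
theorem sum_card_goodS_not_goodQ_le (hn : 0 < n)
    (hheur : ∀ b i, b ≤ n + 2 → i < n →
      uniformProb (P.Nlen n b i) (Bad Ad P.Lang (P.Nlen n b i) (P.mOf n b i)) ≤ 1 / P.mOf n b i) :
    ((∑ x : List.Vector Bool n, (univ.filter fun s : List.Vector Bool (P.Dn n) =>
        P.GoodS x s.toList ∧ ¬ P.GoodQ Ad x s.toList).card : ℕ) : ℝ) ≤ 1 / 32 * 2 ^ (n + P.Dn n) := by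
  -- the per-(x, i) bad-query counts
  set T : List.Vector Bool n → ℕ → ℕ := fun x i => (univ.filter fun s : List.Vector Bool (P.Dn n) =>
      P.GoodS x s.toList ∧ P.squery n (P.lvl x) i (P.f x.toList) s.toList ∈
        Bad Ad P.Lang (P.Nlen n (P.lvl x) i) (P.mOf n (P.lvl x) i)).card with hT
  -- union bound over `i`
  have hunion : ∀ x : List.Vector Bool n, (univ.filter fun s : List.Vector Bool (P.Dn n) =>
      P.GoodS x s.toList ∧ ¬ P.GoodQ Ad x s.toList).card ≤ ∑ i ∈ range n, T x i := by
    intro x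
    refine (card_le_card fun s hs => ?_).trans card_biUnion_le
    obtain ⟨hg, hq⟩ := (mem_filter.1 hs).2
    simp only [GoodQ, not_forall, exists_prop, not_not] at hq
    obtain ⟨i, hi, hbad⟩ := hq
    exact mem_biUnion.2 ⟨i, mem_range.2 hi, mem_filter.2 ⟨mem_univ _, hg, hbad⟩⟩
  -- partition `x` by its level `b < n + 3` and apply domination
  have hlevel : ∀ i ∈ range n, ((∑ x : List.Vector Bool n, T x i : ℕ) : ℝ) ≤ (n + 3) * (8 * 2 ^ (n + P.Dn n) / m0 n) := by
    intro i hi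
    rw [mem_range] at hi
    have hfib : ∑ x : List.Vector Bool n, T x i =
        ∑ b ∈ range (n + 3), ∑ x ∈ univ.filter (fun x : List.Vector Bool n => P.lvl x = b), T x i := by
      rw [sum_fiberwise_of_maps_to (g := P.lvl) (fun x _ => mem_range.2 (by have := P.lvl_le x; omega))]
    rw [hfib, Nat.cast_sum]
    have hb : ∀ b ∈ range (n + 3), ((∑ x ∈ univ.filter (fun x : List.Vector Bool n => P.lvl x = b), T x i : ℕ) : ℝ) ≤
        8 * 2 ^ (n + P.Dn n) / m0 n := by
      intro b hb
      have hb' : b ≤ n + 2 := by rw [mem_range] at hb; omega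
      have hrw : ∑ x ∈ univ.filter (fun x : List.Vector Bool n => P.lvl x = b), T x i =
          ∑ x ∈ univ.filter (fun x : List.Vector Bool n => P.lvl x = b),
            (univ.filter fun s : List.Vector Bool (P.Dn n) =>
              P.GoodS x s.toList ∧ P.squery n b i (P.f x.toList) s.toList ∈ Bad Ad P.Lang (P.Nlen n b i) (P.mOf n b i)).card := by
        refine sum_congr rfl fun x hx => ?_
        rw [hT]
        have hl : P.lvl x = b := (mem_filter.1 hx).2
        simp only [hl]
      rw [hrw]
      have hdom := P.sum_card_good_and_mem_le hb' hi (Bad Ad P.Lang (P.Nlen n b i) (P.mOf n b i))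
      have hm := hheur b i hb' hi
      have hm0 : (0 : ℝ) < m0 n := by exact_mod_cast m0_pos hn
      have hm0le : (m0 n : ℝ) ≤ P.mOf n b i := by exact_mod_cast P.m0_le_mOf n b i
      have hmOf : (0 : ℝ) < P.mOf n b i := lt_of_lt_of_le hm0 hm0le
      calc _ ≤ 8 * 2 ^ (n + P.Dn n) * uniformProb (P.Nlen n b i) (Bad Ad P.Lang (P.Nlen n b i) (P.mOf n b i)) := hdom
        _ ≤ 8 * 2 ^ (n + P.Dn n) * (1 / P.mOf n b i) := by gcongr
        _ ≤ 8 * 2 ^ (n + P.Dn n) * (1 / m0 n) := by gcongr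
        _ = 8 * 2 ^ (n + P.Dn n) / m0 n := by ring
    calc _ ≤ ∑ b ∈ range (n + 3), (8 * 2 ^ (n + P.Dn n) / m0 n : ℝ) := sum_le_sum hb
      _ = (n + 3) * (8 * 2 ^ (n + P.Dn n) / m0 n) := by rw [sum_const, card_range, nsmul_eq_mul]; push_cast; ring
  have hn' : (0 : ℝ) < n := by exact_mod_cast hn
  calc ((∑ x : List.Vector Bool n, (univ.filter fun s : List.Vector Bool (P.Dn n) =>
        P.GoodS x s.toList ∧ ¬ P.GoodQ Ad x s.toList).card : ℕ) : ℝ)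
      ≤ ((∑ x : List.Vector Bool n, ∑ i ∈ range n, T x i : ℕ) : ℝ) := by exact_mod_cast sum_le_sum fun x _ => hunion x
    _ = ∑ i ∈ range n, ((∑ x : List.Vector Bool n, T x i : ℕ) : ℝ) := by rw [sum_comm]; push_cast; rfl
    _ ≤ ∑ i ∈ range n, ((n + 3) * (8 * 2 ^ (n + P.Dn n) / m0 n) : ℝ) := sum_le_sum hlevel
    _ = n * ((n + 3) * (8 * 2 ^ (n + P.Dn n) / m0 n)) := by rw [sum_const, card_range, nsmul_eq_mul]
    _ = 1 / 32 * 2 ^ (n + P.Dn n) := by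
        unfold m0; push_cast
        field_simp
        ring

/-- **The round at the true level and coin length bounds the inversion probability from below**:
`#{hits of the round}/2^{R(n)} ≤ Pr_r[I inverts f x]` (a hit of the round is a hit of the run,
`f_run_eq`; the round segment is a uniform window of the coins, `card_filter_window`).
[Bogdanov–Trevisan 2006, proof of Claim 28] [cite: BogdanovTrevisan2006, Claim 28 (ECCC TR06-073 §5.1.1)] -/
theorem pr_inv_ge {κ : ℕ} (hκQ : κ ≤ P.Q Ad n) (x : List.Vector Bool n) :
    ((univ.filter fun sd : List.Vector Bool (P.Rn Ad n) =>
        P.f (P.cand Ad n (P.lvl x) κ (P.f x.toList) sd.toList) = P.f x.toList).card : ℝ) / 2 ^ P.Rn Ad n ≤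
      (P.inv Ad).pr id (boolPair (unaryEncodeNat n) (P.f x.toList)) {z | P.f z = P.f x.toList} := by
  set inp := boolPair (unaryEncodeNat n) (P.f x.toList) with hinp
  set cl := P.coinLen Ad inp.length with hcl
  set j := κ * (n + 3) + P.lvl x with hj
  have hb3 : P.lvl x < n + 3 := by have := P.lvl_le x; omega
  have hjr : j < P.rounds Ad n := P.roundIdx_lt Ad hb3 hκQ
  have hnl : n ≤ inp.length := by
    rw [hinp, length_boolPair, length_unaryEncodeNat]; omega
  have hfit : (j + 1) * P.Rn Ad n ≤ cl :=
    (Nat.mul_le_mul_right _ hjr).trans (P.rounds_mul_Rn_le_coinLen Ad hnl)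
  obtain ⟨post, hpost⟩ : ∃ post, cl = j * P.Rn Ad n + (P.Rn Ad n + post) :=
    ⟨cl - (j * P.Rn Ad n + P.Rn Ad n), by
      have h := hfit
      rw [Nat.add_mul, one_mul] at h
      generalize j * P.Rn Ad n = jR at h ⊢
      omega⟩
  rw [Yao.Params.prCount_eq (P.inv Ad) id inp {z : List Bool | P.f z = P.f x.toList} (κ := cl) rfl]
  -- hits of the round `j` are hits of the run
  have hmono : (univ.filter fun r : List.Vector Bool cl =>
      P.f (P.cand Ad n (P.lvl x) κ (P.f x.toList) ((r.toList.drop (j * P.Rn Ad n)).take (P.Rn Ad n))) = P.f x.toList).card ≤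
      (univ.filter fun r : List.Vector Bool cl =>
        (P.inv Ad).run inp r.toList ∈ {z : List Bool | P.f z = P.f x.toList}).card := by
    refine card_le_card fun r hr => mem_filter.2 ⟨mem_univ _, ?_⟩
    have hhit := (mem_filter.1 hr).2
    simp only [Set.mem_setOf_eq]
    refine P.f_run_eq Ad hjr ?_
    rw [hj, P.roundOut_eq Ad hb3]
    exact hhit
  have hwin := card_filter_window (j * P.Rn Ad n) (P.Rn Ad n) post
    (fun sd => P.f (P.cand Ad n (P.lvl x) κ (P.f x.toList) sd) = P.f x.toList)
  have hcount : (univ.filter fun sd : List.Vector Bool (P.Rn Ad n) =>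
      P.f (P.cand Ad n (P.lvl x) κ (P.f x.toList) sd.toList) = P.f x.toList).card * 2 ^ cl ≤
      (univ.filter fun r : List.Vector Bool cl =>
        (P.inv Ad).run inp r.toList ∈ {z : List Bool | P.f z = P.f x.toList}).card * 2 ^ P.Rn Ad n := by
    have h1 : (univ.filter fun r : List.Vector Bool cl =>
        P.f (P.cand Ad n (P.lvl x) κ (P.f x.toList) ((r.toList.drop (j * P.Rn Ad n)).take (P.Rn Ad n))) = P.f x.toList).card =
        2 ^ (j * P.Rn Ad n) * ((univ.filter fun sd : List.Vector Bool (P.Rn Ad n) =>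
          P.f (P.cand Ad n (P.lvl x) κ (P.f x.toList) sd.toList) = P.f x.toList).card * 2 ^ post) := by
      rw [Yao.card_filter_vector_congr hpost (fun r =>
        P.f (P.cand Ad n (P.lvl x) κ (P.f x.toList) ((r.drop (j * P.Rn Ad n)).take (P.Rn Ad n))) = P.f x.toList)]
      exact hwin
    have h2 : 2 ^ cl = 2 ^ (j * P.Rn Ad n) * 2 ^ P.Rn Ad n * 2 ^ post := by rw [hpost, pow_add, pow_add, mul_assoc]
    rw [h1] at hmono
    calc _ = 2 ^ (j * P.Rn Ad n) * ((univ.filter fun sd : List.Vector Bool (P.Rn Ad n) =>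
          P.f (P.cand Ad n (P.lvl x) κ (P.f x.toList) sd.toList) = P.f x.toList).card * 2 ^ post) * 2 ^ P.Rn Ad n := by
          rw [h2]; ring
      _ ≤ _ := Nat.mul_le_mul_right _ hmono
  have hcount' : ((univ.filter fun sd : List.Vector Bool (P.Rn Ad n) =>
      P.f (P.cand Ad n (P.lvl x) κ (P.f x.toList) sd.toList) = P.f x.toList).card : ℝ) * 2 ^ cl ≤
      ((univ.filter fun r : List.Vector Bool cl =>
        (P.inv Ad).run inp r.toList ∈ {z : List Bool | P.f z = P.f x.toList}).card : ℝ) * 2 ^ P.Rn Ad n := by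
    exact_mod_cast hcount
  rw [div_le_div_iff₀ (by positivity) (by positivity)]
  exact hcount'

/-- **Bogdanov–Trevisan's Theorem 22, quantitative core.** If the heuristic scheme `A` has uniform
bad-instance mass `≤ 1/m` on `(L_f, U)` at the parameters of the queries at `n ≥ 1` (and
`coinLen_A(s(n)) ≤ q_A(s(n))`, `|f x| ≤ p(|x|)`), then the inverter inverts `f` on a uniformly random
`n`-bit input with probability at least `31/1024`:
`Pr_{x ∼ U_n, coins}[f(I(1ⁿ, f x)) = f x] ≥ (1/16 - 1/32) · 31/32`. [Bogdanov–Trevisan 2006,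
Thm. 22 with Claim 28, Thm. 29, Thm. 21] [cite: BogdanovTrevisan2006, Thm. 22 (ECCC TR06-073 §3.3)] -/
theorem invertProb_ge (hP : ∀ x, (P.f x).length ≤ P.p.eval x.length) (hn : 0 < n) (hκQ : Ad.A.coinLen (P.slen n) ≤ P.Q Ad n)
    (hheur : ∀ b i, b ≤ n + 2 → i < n →
      uniformProb (P.Nlen n b i) (Bad Ad P.Lang (P.Nlen n b i) (P.mOf n b i)) ≤ 1 / P.mOf n b i) :
    (31 / 1024 : ℝ) ≤ invertProb P.f (P.inv Ad) n := by
  set κ := Ad.A.coinLen (P.slen n) with hκ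
  -- per `x`: probability ≥ hits / 2^Rn ≥ (31/32) 2^Cn #{good seeds with good queries} / 2^Rn
  have hx : ∀ x : List.Vector Bool n,
      ((univ.filter fun s : List.Vector Bool (P.Dn n) => P.GoodS x s.toList ∧ P.GoodQ Ad x s.toList).card : ℝ) *
          (31 / 32 * 2 ^ P.Cn Ad n) / 2 ^ P.Rn Ad n ≤
        (P.inv Ad).pr id (boolPair (unaryEncodeNat n) (P.f x.toList)) {z | P.f z = P.f x.toList} := by
    intro x
    refine le_trans ?_ (P.pr_inv_ge Ad hκQ x)
    gcongr
    exact P.card_hit_ge Ad hn hκ.symm hκQ x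
  -- sum over `x`: good seeds minus bad queries
  have hsplit : ∀ x : List.Vector Bool n,
      ((univ.filter fun s : List.Vector Bool (P.Dn n) => P.GoodS x s.toList ∧ P.GoodQ Ad x s.toList).card : ℝ) =
        (univ.filter fun s : List.Vector Bool (P.Dn n) => P.GoodS x s.toList).card -
          (univ.filter fun s : List.Vector Bool (P.Dn n) => P.GoodS x s.toList ∧ ¬ P.GoodQ Ad x s.toList).card := by
    intro x
    have h := Finset.card_filter_add_card_filter_not
      (s := univ.filter fun s : List.Vector Bool (P.Dn n) => P.GoodS x s.toList) (fun s => P.GoodQ Ad x s.toList)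
    rw [filter_filter, filter_filter] at h
    have h' : ((univ.filter fun s : List.Vector Bool (P.Dn n) => P.GoodS x s.toList ∧ P.GoodQ Ad x s.toList).card : ℝ) +
        (univ.filter fun s : List.Vector Bool (P.Dn n) => P.GoodS x s.toList ∧ ¬ P.GoodQ Ad x s.toList).card =
        (univ.filter fun s : List.Vector Bool (P.Dn n) => P.GoodS x s.toList).card := by exact_mod_cast h
    linarith
  have hgood : ∀ x : List.Vector Bool n, (2 ^ P.Dn n : ℝ) / 16 ≤
      (univ.filter fun s : List.Vector Bool (P.Dn n) => P.GoodS x s.toList).card := by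
    intro x
    have h := P.card_goodS_ge hP x
    have h' : ((2 ^ P.Dn n : ℕ) : ℝ) ≤ ((16 * (univ.filter fun s : List.Vector Bool (P.Dn n) => P.GoodS x s.toList).card : ℕ) : ℝ) := by
      exact_mod_cast h
    push_cast at h'
    linarith
  have hbad := P.sum_card_goodS_not_goodQ_le Ad hn hheur
  push_cast at hbad
  -- assemble
  unfold invertProb uniformAvg
  rw [le_div_iff₀ (by positivity)]
  have hsum : ∑ x : List.Vector Bool n,
      ((univ.filter fun s : List.Vector Bool (P.Dn n) => P.GoodS x s.toList ∧ P.GoodQ Ad x s.toList).card : ℝ) ≥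
        2 ^ n * (2 ^ P.Dn n / 16) - 1 / 32 * 2 ^ (n + P.Dn n) := by
    rw [sum_congr rfl fun x _ => hsplit x, sum_sub_distrib]
    have h1 : (2 : ℝ) ^ n * (2 ^ P.Dn n / 16) ≤ ∑ x : List.Vector Bool n,
        ((univ.filter fun s : List.Vector Bool (P.Dn n) => P.GoodS x s.toList).card : ℝ) := by
      calc (2 : ℝ) ^ n * (2 ^ P.Dn n / 16) = ∑ _x : List.Vector Bool n, (2 ^ P.Dn n : ℝ) / 16 := by
            rw [sum_const, card_univ, card_vector, Fintype.card_bool, nsmul_eq_mul]; push_cast; ring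
        _ ≤ _ := sum_le_sum fun x _ => hgood x
    linarith
  have hRn : (2 : ℝ) ^ P.Rn Ad n = 2 ^ P.Dn n * 2 ^ P.Cn Ad n := by rw [← pow_add]; rfl
  calc (31 / 1024 : ℝ) * 2 ^ n = (2 ^ n * (2 ^ P.Dn n / 16) - 1 / 32 * 2 ^ (n + P.Dn n)) * (31 / 32 * 2 ^ P.Cn Ad n) /
        2 ^ P.Rn Ad n := by
        rw [hRn, pow_add]; field_simp; ring
    _ ≤ (∑ x : List.Vector Bool n,
          ((univ.filter fun s : List.Vector Bool (P.Dn n) => P.GoodS x s.toList ∧ P.GoodQ Ad x s.toList).card : ℝ)) *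
          (31 / 32 * 2 ^ P.Cn Ad n) / 2 ^ P.Rn Ad n := by gcongr
    _ = ∑ x : List.Vector Bool n,
          ((univ.filter fun s : List.Vector Bool (P.Dn n) => P.GoodS x s.toList ∧ P.GoodQ Ad x s.toList).card : ℝ) *
            (31 / 32 * 2 ^ P.Cn Ad n) / 2 ^ P.Rn Ad n := by rw [sum_mul, sum_div]
    _ ≤ ∑ x : List.Vector Bool n, (P.inv Ad).pr id (boolPair (unaryEncodeNat n) (P.f x.toList)) {z | P.f z = P.f x.toList} :=
        sum_le_sum fun x _ => hx x

end Assembly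

end Params

/-! ### Theorem 22 and the exclusion of one-way functions -/

section Main

/-- A sequence bounded below by a positive constant at all `n ≥ 1` is not negligible. [Goldreich 2001,
Def. 1.3.5] [folklore] -/
theorem not_superpolynomialDecay_of_le {u : ℕ → ℝ} {c : ℝ} (hc : 0 < c) (h : ∀ n, 0 < n → c ≤ u n) :
    ¬ SuperpolynomialDecay atTop (fun n : ℕ => (n : ℝ)) u := by
  intro hd
  have h0 := hd 0
  simp only [pow_zero, one_mul] at h0
  have hev : ∀ᶠ n : ℕ in atTop, u n < c := h0.eventually (gt_mem_nhds hc)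
  obtain ⟨N, hN⟩ := Filter.eventually_atTop.1 hev
  have h1 := hN (N + 1) (Nat.le_succ N)
  have h2 := h (N + 1) (Nat.succ_pos N)
  linarith

/-- **Bogdanov–Trevisan, Theorem 22** (ECCC TR06-073 §3.3; FnT TCS 2(1) §4.3; via their §5: Thm. 29
with Claim 28 and Thm. 21): **if `(NP, U) ⊆ HeurBPP` then no function is one-way** — every
polynomial-time `f` is inverted by the PPT inverter `I` on a `≥ 31/1024` fraction of `x ∼ U_n` for
every `n ≥ 1`, which is not negligible. The two efficiency statements (the verifier relation of
`L_f` is in `P` for polynomial-time `f`; `I` is PPT for polynomial-time `f` and `A`) enter as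
hypotheses and are proved in `ImpagliazzoLevinVerifier.lean` / `ImpagliazzoLevinInverter.lean`.
[Bogdanov–Trevisan 2006, Thm. 22; Impagliazzo–Levin 1990] [cite: BogdanovTrevisan2006, Thm. 22 (ECCC TR06-073 §3.3)] -/
theorem not_isOneWay_of_subset_HeurBPP
    (hRel : ∀ P : Params, PolyTimeComputable (id : List Bool → List Bool) (id : List Bool → List Bool) P.f →
      P.Rel ∈ Classes.P)
    (hPPT : ∀ (P : Params) (Ad : Adv), PolyTimeComputable (id : List Bool → List Bool) (id : List Bool → List Bool) P.f →
      Ad.A.IsPolyTime schemeEnc encodeBool → IsPPT (P.inv Ad) id)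
    (hsub : distClass NP {MetaComplexity.uniformEnsemble} ⊆ HeurBPP) (f : List Bool → List Bool) : ¬ IsOneWay f := by
  rintro ⟨hfc, hneg⟩
  obtain ⟨p, hp⟩ := exists_poly_length_le_of_mem_FP hfc
  set P : Params := ⟨f, p⟩ with hPdef
  have hLen : ∀ x, (P.f x).length ≤ P.p.eval x.length := hp
  have hL : P.Lang ∈ NP := P.Lang_mem_NP_of (hRel P hfc)
  have hQ : (⟨P.Lang, MetaComplexity.uniformEnsemble⟩ : DistProblem) ∈ HeurBPP := hsub ⟨hL, Set.mem_singleton _⟩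
  obtain ⟨A, hA, hheur⟩ := hQ
  obtain ⟨qA, hqA⟩ := hA.2
  set Ad : Adv := ⟨A, qA⟩ with hAd
  have hppt : IsPPT (P.inv Ad) id := hPPT P Ad hfc hA
  have hbound : ∀ n, 0 < n → (31 / 1024 : ℝ) ≤ invertProb f (P.inv Ad) n := by
    intro n hn
    refine P.invertProb_ge Ad hLen hn (hqA _) fun b i hb hi => ?_
    have h := hheur (P.Nlen n b i) (P.mOf n b i) (lt_of_lt_of_le (Params.m0_pos hn) (P.m0_le_mOf n b i))
    rw [prob_uniformEnsemble] at h
    exact h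
  exact not_superpolynomialDecay_of_le (by norm_num) hbound (hneg (P.inv Ad) hppt)

/-- **crypto-foundations.S25 from the two efficiency statements**: one-way functions exclude
`(NP, U) ⊆ HeurBPP` (`Literature.Computability.Cryptography.distClass_NP_uniform_not_subset_HeurBPP_of_OWFExist`,
the contrapositive of Bogdanov–Trevisan's Theorem 22). [Bogdanov–Trevisan 2006, Thm. 22;
Impagliazzo–Levin 1990] [cite: BogdanovTrevisan2006, Thm. 22 (ECCC TR06-073 §3.3)] -/
theorem distClass_NP_uniform_not_subset_HeurBPP_of_OWFExist_of
    (hRel : ∀ P : Params, PolyTimeComputable (id : List Bool → List Bool) (id : List Bool → List Bool) P.f →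
      P.Rel ∈ Classes.P)
    (hPPT : ∀ (P : Params) (Ad : Adv), PolyTimeComputable (id : List Bool → List Bool) (id : List Bool → List Bool) P.f →
      Ad.A.IsPolyTime schemeEnc encodeBool → IsPPT (P.inv Ad) id) :
    distClass_NP_uniform_not_subset_HeurBPP_of_OWFExist :=
  fun ⟨f, hf⟩ hsub => not_isOneWay_of_subset_HeurBPP hRel hPPT hsub f hf

end Main

end ImpagliazzoLevin

end Literature.Computability.Cryptography

end
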